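import Literature.Probability.FitznerVanDerHofstad2017.NobleWeightedConvolution
import HarnessLib

/-!
# [NoBLE17] App. D, Steps 3–5 for `R_F` — module 3c-B: the non-local terms of `F_p`, the majorant `m` of
`(R_F)₋`, its displacement bound (D.32), and Prop. 4.5(ii) with every App. D constant constructed

Fitzner–van der Hofstad, *Generalized approach to the non-backtracking lace expansion*, Probab. Theory
Relat. Fields **169** (2017) 1041–1119 (= arXiv:1506.07969, "NoBLE17"): §4.1.2–4.1.3 (the rewrite, (4.11)–(4.19),
pp. 1082–1083), Appendix D Step 3 "The remainder term of `F`" (D.15)–(D.24) (pp. 1113–1115), Step 4 "Bound in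
terms of a convolution" (D.24)–(D.29) (pp. 1115–1116), Step 5 "Conclusion" (D.30)–(D.32) (p. 1117), Lemma 2.12
(p. 1063), Assumptions 4.1–4.3 (pp. 1085–1088); Fitzner–van der Hofstad, *Mean-field behavior for nearest-neighbor
percolation in `d > 10`*, Electron. J. Probab. **22** (2017) (= arXiv:1506.07977), §3.5 (symmetry of the model).

Module 3b (`NobleKSpaceRewriteF.lean`) constructed `c_F`, `α_F` and the remainder `R_F := F − c_F δ − α_F D`
and reduced (D.32) — `R̂_F(0) − R̂_F(k) ≥ −β_{ΔR,F}(1 − D̂(k))` — to the EXISTENCE of a summable, totally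
rotationally symmetric `m ≥ 0` with `−m ≤ R_F` pointwise and `Σ_x ‖x‖₂² m(x) ≤ β` (`nobleFRem_lower_of_majorant`,
Lemma 2.12).  This module CONSTRUCTS that majorant and PROVES its three properties, following App. D Steps 3–5
with the convolution engine of module 3c-A (`NobleWeightedConvolution.lean`):

* Part D — Step 3: the Neumann series `F = Σ_ι (𝟙 + μD_ι)(Σ_n Aⁿ u)_ι` is split, direction by direction, into
  the seed term, the first-order term `(A u)_ι` and the tail `(A²Σ_n Aⁿu)_ι` ((D.15)–(D.23)); subtracting the
  local part `F^α` (the `α`-split of Assumption 4.1, §4.1.1) leaves, for each direction `ι`, SIX non-local terms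
  `T₁,…,T₆` (`nobleFRemT1 … nobleFRemT6`, `nobleFDirRem`), and `R_F = Σ_ι (T₁ + ⋯ + T₆)_ι` pointwise
  (`nobleFRem_eq_sum_dirRem`; the identity `R_F = F − F^α` is module 3b's `nobleFRem_eq`).
* Part E — Steps 4–5: the majorant `m := M₁ + Σ_ι (M₂ + ⋯ + M₆)_ι` (`nobleMaj`), each `M_j` a non-negative
  combination of the parity classes `Ξ^{[·]}`, `Ξ^{[·],ι}` of module 3c-A, the remainders `Ψ_{R,I}`, `Ψ_{R,II}`,
  `Π_R` of Assumption 4.1 and the scalar iteration `T_{n+1} = B ⋆ T_n` of (D.6)–(D.8), with the constants of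
  Assumption 4.3 at the record `i` (the comparisons `μ_p ≤ μ`, `p̄ ≤ μ̄`, `p̄/μ_p ≤ β_{μ̄/μ}` are bundled in
  `NobleScalarFacts`, proved from `NobleInputsWF` and Assumption 4.3 by `nobleScalarFacts_of`).
* Part F — the three properties: (F1) mass-and-displacement bounds `MomentBound (M_j) L_j W_j` from Assumption 4.3
  ((4.31)–(4.33), (4.44)–(4.49)) and the engine's closure rules, the geometric tail (D.29) requiring the side
  condition `t = 2dμ̄β^abs_{Ξ^ι}/(1−μ) < 1` (a conjunct of `NobleInputsWF`), and the `ring` identity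
  `nobleMajW_eq`: the assembled displacement constant IS `BetaMap.betaRfDeltaCorr` of module 3c-A evaluated at `i`;
  (F2) the pointwise domination `−M_j ≤ T_j`, hence `−m ≤ R_F` (`neg_nobleMaj_le_nobleFRem`) — the sign
  bookkeeping of Step 5 ("decompose all summands … into a negative and a positive part", p. 1117) on the parity
  decompositions `Ψ = Ψ^{[even]} − Ψ^{[odd]}`, `Π = Π^{(0)} − (Π^{[odd]} − Π^{[even≥2]})` of module 3c-A;
  (F3) total rotational symmetry of `m` (`isTRS_nobleMaj`) by transport under the signed coordinate permutations
  ([FvdH17, §3.5]), given Assumption 4.1 (4.27) and the TRS of the shifted `α`-sums (theorems for percolation).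
* Part G — assembly: `nobleSimplifiedFormAt_of_assumptions₅` / `nobleSimplifiedFormAt_percolation₅`: under the
  NoBLE equation at `p`, Assumption 4.3 at `p` with a well-formed record `i` (for a general split also Assumption
  4.1 and the shifted-`α` TRS), and the four DECIDABLE sign conditions (N1') `0 ≤ c̲_Φ(i)`, (N2)
  `β^abs_Ξ + β^abs_{Ξ^ι} < 1`, (N3) `β_Ψ(i) < 1`, (N4) `0 ≤ α̲_F(i)`, the simplified rewrite
  `NobleSimplifiedFormAt d p (nobleBetaOfInputsCorr d i)` HOLDS, with all six constants `c_Φ, α_Φ, R_Φ, c_F, α_F,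
  R_F` constructed and (D.2), (D.3), (D.4), (D.14), (D.32) proved; axioms `[propext, Classical.choice, Quot.sound]`.

Programme divergence note (DIVERGENCE **D65**, HOME/DIVERGENCE.md; evidence `HOME/b2b-lace-oracle/g7/D32-LINE7.md`):
the bookkeeping of Steps 3–5 carried out here yields, for the `βΔ` slot, the constant `betaRfDeltaCorr(i)`; the
generated table `nobleBetaOfInputs` (wiring of the notebook `Percolation.nb`, In[1218]–[1237]) carries in that slot
the transcription `−betaRfDeltaLower(i)` of the display (D.32).  The two expressions coincide in lines 1–6 of
(D.32) and differ in the parity pairing of lines 7–9 (module 3c-A records the difference as the `ring` identity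
`betaRfDeltaCorr_add_betaRfDeltaLower`); accordingly this module concludes with the table `nobleBetaOfInputsCorr d i`
(all other slots those of `nobleBetaOfInputs d i`, by `rfl`), and the comparison of the two `βΔ` values at a
concrete record is a matter of evaluation, outside this file.  The generated file `BetaMap.lean` is NOT modified;
nothing here is specific to a dimension; no numeral of record is touched.
-/

noncomputable section

namespace Literature.Probability.FitznerVanDerHofstad2017

open _root_.MeasureTheory _root_.Filter _root_.Topology Literature.Probability.LatticeModels
open Literature.Barriers.CriticalPhenomena Literature.Probability.Percolation
open scoped BigOperators

variable {d : ℕ}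

/-! ## Part D (module 3c-B). The non-local terms of `F_p` ([NoBLE17] §4.1.2–4.1.3, App. D (D.30)–(D.31))

`s_ι = u_ι − (A u)_ι + s_ι(A²u)` (the Neumann series (4.9)–(4.10) minus its first two terms), the evaluation of the
convolutions with the seed `u_ι = c(δ_{·+e_ι} − μ δ)` (`c = (1−μ²)⁻¹`), and the resulting pointwise identity
`F_p = F^α + Σ_ι R^F_ι` with an explicit per-direction remainder `R^F_ι` (the terms listed in (D.30)–(D.31):
the `n ≥ 2` matrix powers, the `N ≥ 2` classes of `Ψ`, the `Ψ`-remainders, the `Π`-remainder and `N ≥ 1` classes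
of `Π`, the three `μ`-weighted `Π`-terms of `A u`, and the cross terms `Ψ^ι ⋆ (A u)_ι`). -/

section FSplit

local notation "𝐞" => Literature.Probability.Percolation.stepVec

variable {p : unitInterval} {P X : ℝ}

/-! ### Convolution with the seed -/

/-- `|δ_{0,y}| ≤ 1`. [folklore] -/
theorem abs_nobleDelta_le_one (y : Site d) : |nobleDelta y| ≤ 1 := by
  unfold nobleDelta; split_ifs <;> simp

/-- `0 ≤ δ_{0,y}`. [folklore] -/
theorem nobleDelta_nonneg (y : Site d) : 0 ≤ nobleDelta y := by
  unfold nobleDelta; split_ifs <;> simp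

/-- `f ⋆ δ = f`. [folklore] -/
theorem lconv_nobleDelta (f : Site d → ℝ) (x : Site d) : lconv f nobleDelta x = f x := by
  unfold lconv nobleDelta
  have h : ∀ y, f y * (if x - y = 0 then (1 : ℝ) else 0) = if y = x then f y else 0 := fun y => by
    by_cases hy : y = x
    · subst hy; simp
    · have : x - y ≠ 0 := fun h => hy (sub_eq_zero.1 h).symm
      simp [hy, this]
  simp_rw [h]
  exact tsum_ite_eq x f

/-- `f ⋆ δ_{·+v} = f(· + v)`. [folklore] -/
theorem lconv_nobleDelta_shift (f : Site d → ℝ) (v x : Site d) :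
    lconv f (fun y => nobleDelta (y + v)) x = f (x + v) := by
  rw [lconv_comp_add, lconv_nobleDelta]

/-- `f ⋆ (g + h) = f⋆g + f⋆h` pointwise (all in `ℓ¹`). [folklore] -/
theorem lconv_add_right_abs {f g h : Site d → ℝ} (hf : Summable fun x => |f x|) (hg : Summable fun x => |g x|)
    (hh : Summable fun x => |h x|) (x : Site d) :
    lconv f (fun z => g z + h z) x = lconv f g x + lconv f h x := by
  unfold lconv
  simp only [mul_add]
  exact (summable_mul_shift hf hg x).tsum_add (summable_mul_shift hf hh x)

/-- **Convolution with the seed**: `(f ⋆ u_ι)(x) = c (f(x + e_ι) − μ_p f(x))` for `f ∈ ℓ¹`.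
[cite: FitznerVanDerHofstad2016NoBLE, §4.1.2 (4.9) (p. 1082)] -/
theorem lconv_nobleSeedU {f : Site d → ℝ} (hf : Summable fun y => |f y|) (ι : Fin d × Bool) (x : Site d) :
    lconv f (nobleSeedU d p ι) x = (1 - nobleMu d p ^ 2)⁻¹ * (f (x + 𝐞 ι) - nobleMu d p * f x) := by
  have h1 : nobleSeedU d p ι = fun y => (1 - nobleMu d p ^ 2)⁻¹ *
      (nobleDelta (y + 𝐞 ι) - nobleMu d p * nobleDelta y) := rfl
  have hs1 : Summable fun y : Site d => |nobleDelta (y + 𝐞 ι)| :=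
    summable_abs_comp_add_right summable_abs_nobleDelta _
  have hs2 : Summable fun y : Site d => |nobleMu d p * nobleDelta y| :=
    summable_abs_const_mul' _ summable_abs_nobleDelta
  rw [h1, lconv_const_mul_right, lconv_sub_right_abs hf hs1 hs2, lconv_const_mul_right, lconv_nobleDelta_shift,
    lconv_nobleDelta]

/-- `(A • u)_ι(x) = c Σ_κ (A^{ι,κ}(x + e_κ) − μ_p A^{ι,κ}(x))` for an `ℓ¹` kernel. [cite: FitznerVanDerHofstad2016NoBLE, §4.1.2 (4.9)–(4.10) (p. 1082)] -/
theorem kapply_nobleSeedU {A : (Fin d × Bool) → (Fin d × Bool) → Site d → ℝ}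
    (hA : ∀ ι κ, Summable fun x => |A ι κ x|) (ι : Fin d × Bool) (x : Site d) :
    kapply A (nobleSeedU d p) ι x =
      (1 - nobleMu d p ^ 2)⁻¹ * ∑ κ, (A ι κ (x + 𝐞 κ) - nobleMu d p * A ι κ x) := by
  unfold kapply
  rw [Finset.mul_sum]
  exact Finset.sum_congr rfl fun κ _ => lconv_nobleSeedU (hA ι κ) κ x

/-- **`(A • u)_ι`** written out: `c² Σ_κ [Π^{ι,κ}(x+e_ι+e_κ) − μ Π^{−ι,κ}(x+e_κ) − μ Π^{ι,κ}(x+e_ι) + μ² Π^{−ι,κ}(x)]`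
(the `n = 1` term `F̂₁` of (4.10) in `x`-space). [cite: FitznerVanDerHofstad2016NoBLE, §4.1.2 (4.10) (p. 1082); §4.1.3 (the `Π_α`-term of F₁) (p. 1083)] -/
def nobleAU (d : ℕ) (p : unitInterval) (ι : Fin d × Bool) (x : Site d) : ℝ :=
  ((1 - nobleMu d p ^ 2)⁻¹) ^ 2 * ∑ κ : Fin d × Bool,
    (noblePi d p ι κ (x + 𝐞 ι + 𝐞 κ) - nobleMu d p * noblePi d p (srev ι) κ (x + 𝐞 κ) -
      nobleMu d p * noblePi d p ι κ (x + 𝐞 ι) + nobleMu d p ^ 2 * noblePi d p (srev ι) κ x)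

/-- `A • u = nobleAU` pointwise. [cite: FitznerVanDerHofstad2016NoBLE, §4.1.2 (4.10) (p. 1082)] -/
theorem kapply_nobleKer_nobleSeedU (h : NobleL1At d p P X) (ι : Fin d × Bool) (x : Site d) :
    kapply (nobleKer d p) (nobleSeedU d p) ι x = nobleAU d p ι x := by
  rw [kapply_nobleSeedU (summable_abs_nobleKer h), nobleAU, Finset.mul_sum, Finset.mul_sum]
  refine Finset.sum_congr rfl fun κ _ => ?_
  simp only [nobleKer, add_right_comm x (𝐞 κ) (𝐞 ι)]
  ring

/-- `A • u = nobleAU` as functions. [folklore] -/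
theorem kapply_nobleKer_nobleSeedU_eq (h : NobleL1At d p P X) :
    kapply (nobleKer d p) (nobleSeedU d p) = nobleAU d p :=
  funext fun ι => funext fun x => kapply_nobleKer_nobleSeedU h ι x

/-- `(A u)_ι ∈ ℓ¹`. [folklore] -/
theorem summable_abs_nobleAU (h : NobleL1At d p P X) (ι : Fin d × Bool) : Summable fun x => |nobleAU d p ι x| := by
  rw [← kapply_nobleKer_nobleSeedU_eq h]
  exact summable_abs_kapply (summable_abs_nobleKer h) (summable_abs_nobleSeedU p) ι

/-! ### The Neumann tail `s_ι(A²u)` -/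

/-- The second Neumann tail `T²_ι := s_ι(A • (A • u)) = Σ_n (−1)^n (A^{n+2} u)_ι`, so that `s_ι = u_ι − (Au)_ι + T²_ι`
(the `n ≥ 2` terms of (4.8)–(4.10); "the term in the first line [of (D.31)]").
[cite: FitznerVanDerHofstad2016NoBLE, §4.1.2 (4.8)–(4.10) (p. 1082); App. D (D.30)–(D.31) (p. 1117)] -/
def nobleSTail2 (d : ℕ) (p : unitInterval) : Fin d × Bool → Site d → ℝ :=
  kseries (nobleKer d p) (kapply (nobleKer d p) (kapply (nobleKer d p) (nobleSeedU d p)))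

/-- Termwise absolute convergence of the Neumann series of `s_ι` at every point. [cite: FitznerVanDerHofstad2016NoBLE, App. D (D.8)] -/
theorem summable_abs_kiter_nobleS [NeZero d] (h : NobleL1At d p P X) (ι : Fin d × Bool) (x : Site d) :
    Summable fun n => |kiter (nobleKer d p) (nobleSeedU d p) n ι x| :=
  (kiter_series_l1 (summable_abs_nobleKer h) (summable_abs_nobleSeedU p) (nobleTheta_nonneg h)
    (nobleTheta_lt_one h) (nobleKer_row_le h) (tsum_abs_nobleSeedU_le h) ι).1 x

/-- `(A^n (A(Au)))_ι = (A^{n+2} u)_ι`. [folklore] -/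
theorem kiter_kapply_kapply {I : Type*} [Fintype I] (A : I → I → Site d → ℝ) (u : I → Site d → ℝ) (n : ℕ) :
    kiter A (kapply A (kapply A u)) n = kiter A u (n + 2) := by
  rw [show n + 2 = n + 1 + 1 from rfl, kiter_succ_eq_kiter_kapply, kiter_succ_eq_kiter_kapply]

/-- **`s_ι = u_ι − (A u)_ι + T²_ι`.** [cite: FitznerVanDerHofstad2016NoBLE, §4.1.2 (4.8)–(4.10) (p. 1082); App. D (D.30)] -/
theorem nobleS_eq_seed_sub_AU_add_tail [NeZero d] (h : NobleL1At d p P X) (ι : Fin d × Bool) (x : Site d) :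
    nobleS d p ι x = nobleSeedU d p ι x - nobleAU d p ι x + nobleSTail2 d p ι x := by
  have h1 : ∀ y, Summable fun n => |kiter (nobleKer d p) (nobleSeedU d p) n ι y| := summable_abs_kiter_nobleS h ι
  have h2 : ∀ y, Summable fun n => |kiter (nobleKer d p) (kapply (nobleKer d p) (nobleSeedU d p)) n ι y| := fun y => by
    simp only [← kiter_succ_eq_kiter_kapply]
    exact (summable_nat_add_iff (f := fun n => |kiter (nobleKer d p) (nobleSeedU d p) n ι y|) 1).2 (h1 y)
  rw [nobleS, kseries_eq_seed_sub h1 x, kseries_eq_seed_sub h2 x, kapply_nobleKer_nobleSeedU h, nobleSTail2]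
  ring

/-- `T²_ι ∈ ℓ¹`. [cite: FitznerVanDerHofstad2016NoBLE, App. D (D.8)] -/
theorem summable_abs_nobleSTail2 [NeZero d] (h : NobleL1At d p P X) (ι : Fin d × Bool) :
    Summable fun x => |nobleSTail2 d p ι x| := by
  have hA := summable_abs_nobleKer h
  have hu := summable_abs_nobleSeedU (d := d) p
  have hθ := nobleKer_row_le h
  have hU := tsum_abs_nobleSeedU_le h
  have hu' : ∀ ι, Summable fun x => |kapply (nobleKer d p) (nobleSeedU d p) ι x| := fun ι => summable_abs_kapply hA hu ι
  have hU' := tsum_abs_kapply_le' hA hu hθ hU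
  exact (kseries_tail_l1 hA hu' (nobleTheta_nonneg h) (nobleTheta_lt_one h) hθ hU' ι).1

/-- `|T²_ι(x)| ≤ Σ_n |(A^{n+2}u)_ι(x)|`. [cite: FitznerVanDerHofstad2016NoBLE, App. D (D.8), (D.29)] -/
theorem abs_nobleSTail2_le [NeZero d] (h : NobleL1At d p P X) (ι : Fin d × Bool) (x : Site d) :
    |nobleSTail2 d p ι x| ≤ ∑' n, |kiter (nobleKer d p) (nobleSeedU d p) (n + 2) ι x| := by
  have h1 : Summable fun n => |kiter (nobleKer d p) (nobleSeedU d p) (n + 2) ι x| :=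
    (summable_nat_add_iff (f := fun n => |kiter (nobleKer d p) (nobleSeedU d p) n ι x|) 2).2
      (summable_abs_kiter_nobleS h ι x)
  unfold nobleSTail2 kseries
  simp only [kiter_kapply_kapply]
  exact abs_tsum_negOnePow_mul_le h1

end FSplit

section FSplit2

local notation "𝐞" => Literature.Probability.Percolation.stepVec

variable {p : unitInterval} {P X : ℝ} {i : BetaMap.Inputs} {S : NobleSplit d p}

/-! ### The six non-local terms of `F_p − F^α` -/

/-- `Ψ^{[even ≥ 2],ι} − Ψ^{[odd ≥ 3],ι}` — the `N ≥ 2` classes of `Ψ^ι = Σ_N (−1)^N Ψ^{(N),ι}`.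
[cite: FitznerVanDerHofstad2016NoBLE, App. D Step 5 (p. 1117) ("decompose all summands … into a negative and a positive part")] -/
def noblePsiTail2 (d : ℕ) (p : unitInterval) (ι : Fin d × Bool) (y : Site d) : ℝ :=
  noblePsiCls d p (fun N => 2 * N + 2) (𝐞 ι) y - noblePsiCls d p (fun N => 2 * N + 3) (𝐞 ι) y

/-- `Π^{[odd],ι,κ} − Π^{[even ≥ 2],ι,κ}` — the `N ≥ 1` classes of `Π^{ι,κ} = Σ_N (−1)^N Π^{(N),ι,κ}`, so that
`Π^{ι,κ} = Π^{(0),ι,κ} − noblePiTail1`. [cite: FitznerVanDerHofstad2016NoBLE, App. D Step 5 (p. 1117)] -/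
def noblePiTail1 (d : ℕ) (p : unitInterval) (ι κ : Fin d × Bool) (y : Site d) : ℝ :=
  noblePiCls d p (fun N => 2 * N + 1) (𝐞 ι) (𝐞 κ) y - noblePiCls d p (fun N => 2 * N + 2) (𝐞 ι) (𝐞 κ) y

/-- Term 1 (matrix powers `n ≥ 2`): `μ (T²_ι(x) + (Ψ^ι ⋆ T²_ι)(x))` — "the term in the first line" of (D.31).
[cite: FitznerVanDerHofstad2016NoBLE, App. D (D.29)–(D.31) (pp. 1116–1117)] -/
def nobleFRemT1 (d : ℕ) (p : unitInterval) (ι : Fin d × Bool) (x : Site d) : ℝ :=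
  nobleMu d p * (nobleSTail2 d p ι x + lconv (noblePsi d p ι) (nobleSTail2 d p ι) x)

/-- Term 2 (the `N ≥ 2` classes of `Ψ` in `μ Ψ^ι ⋆ u_ι`): `μ c (ΨT_ι(x+e_ι) − μ ΨT_ι(x))`.
[cite: FitznerVanDerHofstad2016NoBLE, App. D (D.30) third line ("Σ_{N≥2}") and (D.32) line 4 (p. 1117)] -/
def nobleFRemT2 (d : ℕ) (p : unitInterval) (ι : Fin d × Bool) (x : Site d) : ℝ :=
  nobleMu d p * (1 - nobleMu d p ^ 2)⁻¹ * (noblePsiTail2 d p ι (x + 𝐞 ι) - nobleMu d p * noblePsiTail2 d p ι x)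

/-- Term 3 (the `Ψ`-remainders `N ≤ 1`): `μ c ((Ψ^{(0)}_{R,I} − Ψ^{(1)}_{R,I})(x+e_ι) − μ (Ψ^{(0)}_{R,II} − Ψ^{(1)}_{R,II})(x))`.
[cite: FitznerVanDerHofstad2016NoBLE, App. D (D.30) third line and (D.32) line 4 (`β_{Σ_ι|x+e_ι|²Ψ^{(1)}_{R,I}}`, `β_{ΔΨ^{(0)}_{R,II}}`) (p. 1117)] -/
def nobleFRemT3 (S : NobleSplit d p) (ι : Fin d × Bool) (x : Site d) : ℝ :=
  nobleMu d p * (1 - nobleMu d p ^ 2)⁻¹ *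
    ((S.psiRI 0 ι (x + 𝐞 ι) - S.psiRI 1 ι (x + 𝐞 ι)) - nobleMu d p * (S.psiRII 0 ι x - S.psiRII 1 ι x))

/-- Term 4 (the `Π`-remainder and the `N ≥ 1` classes of `Π` at `x + e_ι + e_κ`):
`−μ c² Σ_κ (Π^{(0),ι,κ}_R − ΠT_{ι,κ})(x+e_ι+e_κ)`.
[cite: FitznerVanDerHofstad2016NoBLE, App. D (D.30) fourth line and (D.32) line 5 (`β_{Δ R,0,ι}`, `β_{Σ_ι|x+e_ι|²Ξ^ι_{α,1}}`) (p. 1117)] -/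
def nobleFRemT4 (S : NobleSplit d p) (ι : Fin d × Bool) (x : Site d) : ℝ :=
  -(nobleMu d p * ((1 - nobleMu d p ^ 2)⁻¹) ^ 2 *
    ∑ κ : Fin d × Bool, (S.piR ι κ (x + 𝐞 ι + 𝐞 κ) - noblePiTail1 d p ι κ (x + 𝐞 ι + 𝐞 κ)))

/-- Term 5 (the three `μ`-weighted `Π`-terms of `(A u)_ι`): `μ² c² Σ_κ (Π^{−ι,κ}(x+e_κ) + Π^{ι,κ}(x+e_ι) − μ Π^{−ι,κ}(x))`.
[cite: FitznerVanDerHofstad2016NoBLE, App. D (D.30) fourth line (`μ_p² Σ_{ι,κ}(…)`) and (D.32) line 6 (p. 1117)] -/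
def nobleFRemT5 (d : ℕ) (p : unitInterval) (ι : Fin d × Bool) (x : Site d) : ℝ :=
  nobleMu d p ^ 2 * ((1 - nobleMu d p ^ 2)⁻¹) ^ 2 *
    ∑ κ : Fin d × Bool, (noblePi d p (srev ι) κ (x + 𝐞 κ) + noblePi d p ι κ (x + 𝐞 ι) -
      nobleMu d p * noblePi d p (srev ι) κ x)

/-- Term 6 (the cross terms): `−μ (Ψ^ι ⋆ (A u)_ι)(x)`.
[cite: FitznerVanDerHofstad2016NoBLE, App. D (D.31) last two lines and (D.32) lines 7–9 (p. 1117)] -/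
def nobleFRemT6 (d : ℕ) (p : unitInterval) (ι : Fin d × Bool) (x : Site d) : ℝ :=
  -(nobleMu d p * lconv (noblePsi d p ι) (nobleAU d p ι) x)

/-- **The per-direction remainder `R^F_ι`** (sum of the six terms). [cite: FitznerVanDerHofstad2016NoBLE, App. D (D.30)–(D.31) (p. 1117)] -/
def nobleFDirRem (S : NobleSplit d p) (ι : Fin d × Bool) (x : Site d) : ℝ :=
  nobleFRemT1 d p ι x + nobleFRemT2 d p ι x + nobleFRemT3 S ι x + nobleFRemT4 S ι x + nobleFRemT5 d p ι x +
    nobleFRemT6 d p ι x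

/-- The per-direction local part: `μc[(δ_{x+e_ι} − μδ_x) + (Ψ^{(0)}_{α,I} − Ψ^{(1)}_{α,I})(x+e_ι) − μ(Ψ^{(0)}_{α,II} − Ψ^{(1)}_{α,II})(x)] − μc² Σ_κ Π^{(0),ι,κ}_α(x+e_ι+e_κ)`.
[cite: FitznerVanDerHofstad2016NoBLE, §4.1.3 (4.15)–(4.16) (pp. 1082–1083)] -/
def nobleFAlphaDir (S : NobleSplit d p) (ι : Fin d × Bool) (x : Site d) : ℝ :=
  nobleMu d p * (1 - nobleMu d p ^ 2)⁻¹ *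
      ((nobleDelta (x + 𝐞 ι) - nobleMu d p * nobleDelta x) +
        ((S.psiAI 0 ι (x + 𝐞 ι) - S.psiAI 1 ι (x + 𝐞 ι)) - nobleMu d p * (S.psiAII 0 ι x - S.psiAII 1 ι x))) -
    nobleMu d p * ((1 - nobleMu d p ^ 2)⁻¹) ^ 2 * ∑ κ : Fin d × Bool, S.piA ι κ (x + 𝐞 ι + 𝐞 κ)

/-- `F^α = Σ_ι F^α_ι`. [folklore] -/
theorem nobleFAlpha_eq_sum_dir (S : NobleSplit d p) (x : Site d) :
    nobleFAlpha S x = ∑ ι, nobleFAlphaDir S ι x := by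
  simp only [nobleFAlpha, nobleFAlphaDir, Finset.sum_sub_distrib, Finset.mul_sum]

/-- `Ψ^{(N),ι} = Ψ^{(N),ι}_{α,I} + Ψ^{(N),ι}_{R,I}`. [cite: FitznerVanDerHofstad2016NoBLE, §4.1.1 (pp. 1080–1081)] -/
theorem NobleSplit.psiN_eq_AI_add_RI (S : NobleSplit d p) (N : ℕ) (ι : Fin d × Bool) (y : Site d) :
    noblePsiN d p (𝐞 ι) N y = S.psiAI N ι y + S.psiRI N ι y := by
  rw [NobleSplit.psiRI]; ring

/-- `Ψ^{(N),ι} = Ψ^{(N),ι}_{α,II} + Ψ^{(N),ι}_{R,II}`. [cite: FitznerVanDerHofstad2016NoBLE, §4.1.1 (pp. 1080–1081)] -/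
theorem NobleSplit.psiN_eq_AII_add_RII (S : NobleSplit d p) (N : ℕ) (ι : Fin d × Bool) (y : Site d) :
    noblePsiN d p (𝐞 ι) N y = S.psiAII N ι y + S.psiRII N ι y := by
  rw [NobleSplit.psiRII]; ring

/-- `Π^{(0),ι,κ} = Π^{(0),ι,κ}_α + Π^{(0),ι,κ}_R`. [cite: FitznerVanDerHofstad2016NoBLE, §4.1.1 (pp. 1080–1081)] -/
theorem NobleSplit.piN_zero_eq_A_add_R (S : NobleSplit d p) (ι κ : Fin d × Bool) (y : Site d) :
    noblePiN d p (𝐞 ι) (𝐞 κ) 0 y = S.piA ι κ y + S.piR ι κ y := by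
  rw [NobleSplit.piR]; ring

/-- `Ψ_{R,I}^{(N),ι} ≥ 0` for `N ≤ 1`. [cite: FitznerVanDerHofstad2016NoBLE, §4.1.1 ("non-negative functions")] -/
theorem NobleSplit.psiRI_nonneg (S : NobleSplit d p) {N : ℕ} (hN : N ≤ 1) (ι : Fin d × Bool) (x : Site d) :
    0 ≤ S.psiRI N ι x :=
  sub_nonneg.2 (S.psiAI_le N hN ι x)

/-- `Ψ_{R,II}^{(N),ι} ≥ 0` for `N ≤ 1`. [cite: FitznerVanDerHofstad2016NoBLE, §4.1.1 ("non-negative functions")] -/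
theorem NobleSplit.psiRII_nonneg (S : NobleSplit d p) {N : ℕ} (hN : N ≤ 1) (ι : Fin d × Bool) (x : Site d) :
    0 ≤ S.psiRII N ι x :=
  sub_nonneg.2 (S.psiAII_le N hN ι x)

variable (hd : 2 ≤ d) (hp : p < criticalProbI d)
include hd hp

/-- `(A u)_ι(x)` split along `Π^{ι,κ}(x+e_ι+e_κ) = Π_α + Π_R − ΠT`. [cite: FitznerVanDerHofstad2016NoBLE, §4.1.3 (p. 1083); App. D (D.30)] -/
theorem nobleAU_eq_split (h43 : NobleAssumption43At d p S i) (ι : Fin d × Bool) (x : Site d) :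
    nobleAU d p ι x = ((1 - nobleMu d p ^ 2)⁻¹) ^ 2 *
      ((∑ κ : Fin d × Bool, S.piA ι κ (x + 𝐞 ι + 𝐞 κ)) +
        (∑ κ : Fin d × Bool, (S.piR ι κ (x + 𝐞 ι + 𝐞 κ) - noblePiTail1 d p ι κ (x + 𝐞 ι + 𝐞 κ))) -
        nobleMu d p * ∑ κ : Fin d × Bool, (noblePi d p (srev ι) κ (x + 𝐞 κ) + noblePi d p ι κ (x + 𝐞 ι) -
          nobleMu d p * noblePi d p (srev ι) κ x)) := by
  rw [nobleAU]
  congr 1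
  rw [Finset.mul_sum, ← Finset.sum_add_distrib, ← Finset.sum_sub_distrib]
  refine Finset.sum_congr rfl fun κ _ => ?_
  rw [noblePi_eq_zero_sub_tail hd hp h43 ι κ (x + 𝐞 ι + 𝐞 κ), S.piN_zero_eq_A_add_R, noblePiTail1]
  ring

/-- **`F_p = F^α + Σ_ι R^F_ι` pointwise** (the content of §4.1.2–4.1.3 for `F`: (4.8)–(4.10) with `s = u − Au + T²`,
(4.15)–(4.16), and the split of the coefficients into `α`-parts, remainders and classes).
[cite: FitznerVanDerHofstad2016NoBLE, §4.1.2 (4.8)–(4.10), §4.1.3 (4.15)–(4.17) (pp. 1082–1083); App. D (D.30)–(D.31) (p. 1117)] -/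
theorem nobleF_eq_alpha_add_rem [NeZero d] (h : NobleL1At d p P X) (h43 : NobleAssumption43At d p S i)
    (x : Site d) : nobleF d p x = nobleFAlpha S x + ∑ ι, nobleFDirRem S ι x := by
  have hu := summable_abs_nobleSeedU (d := d) p
  have hAU := summable_abs_nobleAU h
  have hT := summable_abs_nobleSTail2 h
  have hS : ∀ ι, nobleS d p ι = fun y => nobleSeedU d p ι y - nobleAU d p ι y + nobleSTail2 d p ι y :=
    fun ι => funext fun y => nobleS_eq_seed_sub_AU_add_tail h ι y
  have hconv : ∀ ι, lconv (noblePsi d p ι) (nobleS d p ι) x =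
      lconv (noblePsi d p ι) (nobleSeedU d p ι) x - lconv (noblePsi d p ι) (nobleAU d p ι) x +
        lconv (noblePsi d p ι) (nobleSTail2 d p ι) x := fun ι => by
    rw [hS ι, lconv_add_right_abs (h.psi ι) (summable_abs_sub' (hu ι) (hAU ι)) (hT ι),
      lconv_sub_right_abs (h.psi ι) (hu ι) (hAU ι)]
  have hΨ : ∀ ι y, noblePsi d p ι y = noblePsiN d p (𝐞 ι) 0 y - noblePsiN d p (𝐞 ι) 1 y + noblePsiTail2 d p ι y :=
    fun ι y => by rw [noblePsi_eq_zero_sub_one_add_tail hd hp h43 ι y, noblePsiTail2]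
  have hdir : ∀ ι, nobleMu d p * (nobleS d p ι x + lconv (noblePsi d p ι) (nobleS d p ι) x) =
      nobleFAlphaDir S ι x + nobleFDirRem S ι x := fun ι => by
    rw [hconv ι, lconv_nobleSeedU (h.psi ι) ι x, hΨ ι (x + 𝐞 ι), hΨ ι x,
      S.psiN_eq_AI_add_RI 0 ι (x + 𝐞 ι), S.psiN_eq_AI_add_RI 1 ι (x + 𝐞 ι), S.psiN_eq_AII_add_RII 0 ι x,
      S.psiN_eq_AII_add_RII 1 ι x, nobleS_eq_seed_sub_AU_add_tail h ι x, nobleAU_eq_split hd hp h43 ι x,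
      nobleFAlphaDir, nobleFDirRem, nobleFRemT1, nobleFRemT2, nobleFRemT3, nobleFRemT4, nobleFRemT5, nobleFRemT6,
      nobleSeedU]
    ring
  calc nobleF d p x = ∑ ι, nobleMu d p * (nobleS d p ι x + lconv (noblePsi d p ι) (nobleS d p ι) x) := by
        rw [nobleF, Finset.mul_sum]
    _ = ∑ ι, (nobleFAlphaDir S ι x + nobleFDirRem S ι x) := Finset.sum_congr rfl fun ι _ => hdir ι
    _ = nobleFAlpha S x + ∑ ι, nobleFDirRem S ι x := by rw [Finset.sum_add_distrib, nobleFAlpha_eq_sum_dir]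

/-- **`R_F = Σ_ι R^F_ι`** once `F^α` is totally rotationally symmetric (then `c_F δ + (α_F/2d) NN = F^α`).
[cite: FitznerVanDerHofstad2016NoBLE, §4.1.3 (4.17) and the definition of R_F (p. 1083); App. D (D.30)–(D.31)] -/
theorem nobleFRem_eq_sum_dirRem [NeZero d] (h : NobleL1At d p P X) (h43 : NobleAssumption43At d p S i)
    (hT : IsTRS (nobleFAlpha S)) (x : Site d) : nobleFRem S x = ∑ ι, nobleFDirRem S ι x := by
  rw [nobleFRem_eq hT, nobleF_eq_alpha_add_rem hd hp h h43 x]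
  ring

end FSplit2

/-! ## Part E (module 3c-B). The majorant `m` of `(R_F)₋` ([NoBLE17] App. D Steps 4–5)

Every term of `R^F_ι` is bounded below by minus a NON-NEGATIVE function built from the classes of Part B of
module 3c-A, the remainders of Assumption 4.3 and the scalar majorant iteration `T_n` of (D.6)–(D.8), with all
`p`-dependent scalars (`μ_p ≤ μ`, `μ̄_p = p ≤ μ̄`, `μ̄_p/μ_p ≤ β_μ̄/μ`, `(1−μ_p²)⁻¹ ≤ (1−μ²)⁻¹`) replaced by the
record `i` ("we extract the `p`-dependence using `μ_p ≤ μ̄_p`", App. D Step 1). -/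

section Majorant

local notation "𝐞" => Literature.Probability.Percolation.stepVec

variable {p : unitInterval} {P X : ℝ} {i : BetaMap.Inputs} {S : NobleSplit d p}

/-! ### Signed permutations: two more transport facts -/

/-- `σ 0 = 0`. [folklore] -/
theorem zdSignedPermIso_zero (π : Equiv.Perm (Fin d)) (ε : Fin d → ℤˣ) : zdSignedPermIso π ε (0 : Site d) = 0 := by
  have h := zdSignedPermIso_sub π ε (0 : Site d) 0
  rwa [sub_self, sub_self] at h

/-- `σ (−x) = −σ x`. [folklore] -/
theorem zdSignedPermIso_neg (π : Equiv.Perm (Fin d)) (ε : Fin d → ℤˣ) (x : Site d) :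
    zdSignedPermIso π ε (-x) = -zdSignedPermIso π ε x := by
  have h := zdSignedPermIso_sub π ε 0 x
  rwa [zero_sub, zdSignedPermIso_zero, zero_sub] at h

/-- A direction sum is invariant under relabelling the directions by a signed permutation:
`Σ_κ H(σ e_κ) = Σ_κ H(e_κ)`. [cite: FitznerVanDerHofstad2017, §3.5 (arXiv:1506.07977v2 p. 32; EJP pp. 29–30)] -/
theorem sum_dir_relabel (H : Site d → ℝ) (π : Equiv.Perm (Fin d)) (ε : Fin d → ℤˣ) :
    ∑ κ : Fin d × Bool, H (zdSignedPermIso π ε (𝐞 κ)) = ∑ κ : Fin d × Bool, H (𝐞 κ) := by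
  obtain ⟨σ, hσ⟩ := exists_stepVec_perm π ε
  calc ∑ κ : Fin d × Bool, H (zdSignedPermIso π ε (𝐞 κ)) = ∑ κ, H (𝐞 (σ κ)) :=
        Finset.sum_congr rfl fun κ _ => by rw [zdSignedPermIso_apply, hσ]
    _ = ∑ κ, H (𝐞 κ) := Equiv.sum_comp σ (fun κ => H (𝐞 κ))

/-! ### The scalar comparisons `p ↝ i` -/

/-- The scalar comparisons between the `p`-quantities of App. D and the record `i` under which the majorant is
built: `0 < μ_p ≤ μ < 1`, `0 ≤ μ`, `0 ≤ p ≤ μ̄`, `p/μ_p ≤ β_{μ̄/μ}`, `(1−μ_p²)⁻¹ ≤ (1−μ²)⁻¹`. [folklore] -/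
structure NobleScalarFacts (d : ℕ) (p : unitInterval) (i : BetaMap.Inputs) : Prop where
  mu_pos : 0 < nobleMu d p
  mu_le : nobleMu d p ≤ i.mu
  imu_nonneg : 0 ≤ i.mu
  imu_lt_one : i.mu < 1
  pbar_nonneg : 0 ≤ (p : ℝ)
  pbar_le : (p : ℝ) ≤ i.mub
  q_le : (p : ℝ) / nobleMu d p ≤ i.mubOverMu

namespace NobleScalarFacts

variable (h : NobleScalarFacts d p i)
include h

/-- [folklore] -/
theorem mu_nonneg : 0 ≤ nobleMu d p := h.mu_pos.le
/-- [folklore] -/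
theorem mu_lt_one : nobleMu d p < 1 := h.mu_le.trans_lt h.imu_lt_one
/-- [folklore] -/
theorem imub_nonneg : 0 ≤ i.mub := h.pbar_nonneg.trans h.pbar_le
/-- [folklore] -/
theorem q_nonneg : 0 ≤ i.mubOverMu := (div_nonneg h.pbar_nonneg h.mu_nonneg).trans h.q_le
/-- [folklore] -/
theorem qp_nonneg : 0 ≤ (p : ℝ) / nobleMu d p := div_nonneg h.pbar_nonneg h.mu_nonneg
/-- `μ_p · (p/μ_p) = p`. [folklore] -/
theorem mu_mul_qp : nobleMu d p * ((p : ℝ) / nobleMu d p) = (p : ℝ) := mul_div_cancel₀ _ h.mu_pos.ne'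

/-- `μ_p (p̄/μ_p) ≤ μ β_{μ̄/μ}`. [folklore] -/
theorem mu_qp_le : nobleMu d p * ((p : ℝ) / nobleMu d p) ≤ i.mu * i.mubOverMu :=
  mul_le_mul h.mu_le h.q_le h.qp_nonneg h.imu_nonneg
/-- [folklore] -/
theorem one_sub_imu_sq_pos : 0 < 1 - i.mu ^ 2 := by have := h.imu_nonneg; have := h.imu_lt_one; nlinarith
/-- [folklore] -/
theorem one_sub_mu_sq_pos : 0 < 1 - nobleMu d p ^ 2 := by have := h.mu_nonneg; have := h.mu_lt_one; nlinarith
/-- [folklore] -/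
theorem c_nonneg : 0 ≤ (1 - nobleMu d p ^ 2)⁻¹ := inv_nonneg.2 h.one_sub_mu_sq_pos.le
/-- [folklore] -/
theorem ci_nonneg : 0 ≤ (1 - i.mu ^ 2)⁻¹ := inv_nonneg.2 h.one_sub_imu_sq_pos.le
/-- `(1−μ_p²)⁻¹ ≤ (1−μ²)⁻¹`. [folklore] -/
theorem c_le : (1 - nobleMu d p ^ 2)⁻¹ ≤ (1 - i.mu ^ 2)⁻¹ :=
  inv_anti₀ h.one_sub_imu_sq_pos (by have := h.mu_nonneg; have := h.mu_le; nlinarith)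
/-- `μ_p (1−μ_p²)⁻¹ ≤ μ (1−μ²)⁻¹`. [folklore] -/
theorem mu_c_le : nobleMu d p * (1 - nobleMu d p ^ 2)⁻¹ ≤ i.mu * (1 - i.mu ^ 2)⁻¹ :=
  mul_le_mul h.mu_le h.c_le h.c_nonneg h.imu_nonneg
/-- `(1−μ_p²)⁻² ≤ (1−μ²)⁻²`. [folklore] -/
theorem c_sq_le : ((1 - nobleMu d p ^ 2)⁻¹) ^ 2 ≤ ((1 - i.mu ^ 2)⁻¹) ^ 2 :=
  pow_le_pow_left₀ h.c_nonneg h.c_le 2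
/-- `μ_p² ≤ μ²`. [folklore] -/
theorem mu_sq_le : nobleMu d p ^ 2 ≤ i.mu ^ 2 := pow_le_pow_left₀ h.mu_nonneg h.mu_le 2

end NobleScalarFacts

/-- Assumption 4.3's scalar clauses and the well-formedness of `i` give the scalar comparisons.
[cite: FitznerVanDerHofstad2016NoBLE, Assumption 4.3 (4.30) (p. 1086); App. D Step 1 (p. 1110)] -/
theorem nobleScalarFacts_of (hd : 2 ≤ d) (hp : p < criticalProbI d) (hp0 : 0 < (p : ℝ)) (hWF : NobleInputsWF d i) (h43 : NobleAssumption43At d p S i) :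
    NobleScalarFacts d p i := by
  have hp1 : (p : ℝ) < 1 :=
    lt_of_lt_of_le (show (p : ℝ) < (criticalProbI d : ℝ) by exact_mod_cast hp) (criticalProbI d).2.2
  have hμ0 : 0 < nobleMu d p := nobleMu_pos (by omega) hp0 hp1
  exact ⟨hμ0, h43.mu_le, hWF.1.mu_nonneg, hWF.1.mu_lt_one, hp0.le, h43.mub_le, (div_le_iff₀ hμ0).2 h43.mubOverMu⟩

/-! ### The pieces of the majorant -/

/-- `T₀(x) := (1−μ²)⁻¹ (Σ_ι δ_{0,x+e_ι} + 2dμ δ_{0,x}) ≥ Σ_ι |u_ι(x)|` (the seed of (D.6)). [cite: FitznerVanDerHofstad2016NoBLE, §4.1.2 (4.9) (p. 1082); App. D (D.6)] -/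
def nobleMajT0 (d : ℕ) (i : BetaMap.Inputs) (x : Site d) : ℝ :=
  (1 - i.mu ^ 2)⁻¹ * ((∑ ι : Fin d × Bool, nobleDelta (x + 𝐞 ι)) + 2 * d * i.mu * nobleDelta x)

/-- `b_ι(y) := μ̄ (1−μ²)⁻¹ (Ξ^{[abs],ι}(y + e_ι) + μ Ξ^{[abs],−ι}(y)) ≥ |A^{ι,κ}(y)|` for every `κ` ((D.24)). [cite: FitznerVanDerHofstad2016NoBLE, App. D (D.5)–(D.7), (D.24) (pp. 1111, 1115)] -/
def nobleMajBDir (d : ℕ) (p : unitInterval) (i : BetaMap.Inputs) (ι : Fin d × Bool) (y : Site d) : ℝ :=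
  i.mub * (1 - i.mu ^ 2)⁻¹ *
    (nobleXiIotaCls d p (fun N => N) (𝐞 ι) (y + 𝐞 ι) + i.mu * nobleXiIotaCls d p (fun N => N) (𝐞 (srev ι)) y)

/-- `B(y) := Σ_ι b_ι(y)` — the scalar kernel dominating `Σ_ι |A^{ι,κ}|` ((D.7)). [cite: FitznerVanDerHofstad2016NoBLE, App. D (D.7) (p. 1111)] -/
def nobleMajB (d : ℕ) (p : unitInterval) (i : BetaMap.Inputs) : Site d → ℝ :=
  fun y => ∑ ι : Fin d × Bool, nobleMajBDir d p i ι y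

/-- `τ₂(x) := Σ_{n} T_{n+2}(x)`, `T_{n+1} = B ⋆ T_n`, dominating `Σ_ι Σ_{n≥2} |(A^n u)_ι(x)|` ((D.8), (D.29)).
[cite: FitznerVanDerHofstad2016NoBLE, App. D (D.8), (D.29) (pp. 1112, 1116)] -/
def nobleMajTau2 (d : ℕ) (p : unitInterval) (i : BetaMap.Inputs) (x : Site d) : ℝ :=
  ∑' n, titer (nobleMajB d p i) (nobleMajT0 d i) (n + 2) x

/-- Majorant of term 1: `μ τ₂ + μ β_{μ̄/μ} (Ξ^{[abs]} ⋆ τ₂)` ((D.32) lines 1–3). [cite: FitznerVanDerHofstad2016NoBLE, App. D (D.29), (D.31)–(D.32) lines 1–3 (pp. 1116–1117)] -/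
def nobleMajM1 (d : ℕ) (p : unitInterval) (i : BetaMap.Inputs) (x : Site d) : ℝ :=
  i.mu * nobleMajTau2 d p i x + i.mu * i.mubOverMu * lconv (nobleXiCls d p fun N => N) (nobleMajTau2 d p i) x

/-- Majorant of term 2 (direction `ι`): `μ β_{μ̄/μ} (1−μ²)⁻¹ (Ξ^{[odd≥3]}(x+e_ι) + μ Ξ^{[even≥2]}(x))` ((D.32) line 4).
[cite: FitznerVanDerHofstad2016NoBLE, App. D (D.32) line 4 (p. 1117)] -/
def nobleMajM2 (d : ℕ) (p : unitInterval) (i : BetaMap.Inputs) (ι : Fin d × Bool) (x : Site d) : ℝ :=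
  i.mu * i.mubOverMu * (1 - i.mu ^ 2)⁻¹ *
    (nobleXiCls d p (fun N => 2 * N + 3) (x + 𝐞 ι) + i.mu * nobleXiCls d p (fun N => 2 * N + 2) x)

/-- Majorant of term 3 (direction `ι`): `μ (1−μ²)⁻¹ (Ψ^{(1),ι}_{R,I}(x+e_ι) + μ Ψ^{(0),ι}_{R,II}(x))` ((D.32) line 4).
[cite: FitznerVanDerHofstad2016NoBLE, App. D (D.32) line 4 (p. 1117)] -/
def nobleMajM3 (S : NobleSplit d p) (i : BetaMap.Inputs) (ι : Fin d × Bool) (x : Site d) : ℝ :=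
  i.mu * (1 - i.mu ^ 2)⁻¹ * (S.psiRI 1 ι (x + 𝐞 ι) + i.mu * S.psiRII 0 ι x)

/-- Majorant of term 4 (direction `ι`): `μ (1−μ²)⁻² Σ_κ (Π^{(0),ι,κ}_R(x+e_ι+e_κ) + μ̄ Ξ^{[even≥2],ι}(x+e_κ+e_ι))` ((D.32) line 5).
[cite: FitznerVanDerHofstad2016NoBLE, App. D (D.32) line 5 (p. 1117)] -/
def nobleMajM4 (S : NobleSplit d p) (i : BetaMap.Inputs) (ι : Fin d × Bool) (x : Site d) : ℝ :=
  i.mu * ((1 - i.mu ^ 2)⁻¹) ^ 2 *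
    ((∑ κ : Fin d × Bool, S.piR ι κ (x + 𝐞 ι + 𝐞 κ)) +
      i.mub * ∑ κ : Fin d × Bool, nobleXiIotaCls d p (fun N => 2 * N + 2) (𝐞 ι) (x + 𝐞 κ + 𝐞 ι))

/-- Majorant of term 5 (direction `ι`): `μ² μ̄ (1−μ²)⁻² Σ_κ (Ξ^{[odd],−ι}(x+e_κ) + Ξ^{[odd],ι}(x+e_ι) + μ Ξ^{[even],−ι}(x))` ((D.32) line 6).
[cite: FitznerVanDerHofstad2016NoBLE, App. D (D.32) line 6 (p. 1117)] -/
def nobleMajM5 (d : ℕ) (p : unitInterval) (i : BetaMap.Inputs) (ι : Fin d × Bool) (x : Site d) : ℝ :=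
  i.mu ^ 2 * i.mub * ((1 - i.mu ^ 2)⁻¹) ^ 2 *
    ∑ κ : Fin d × Bool, (nobleXiIotaCls d p (fun N => 2 * N + 1) (𝐞 (srev ι)) (x + 𝐞 κ) +
      nobleXiIotaCls d p (fun N => 2 * N + 1) (𝐞 ι) (x + 𝐞 ι) +
        i.mu * nobleXiIotaCls d p (fun N => 2 * N) (𝐞 (srev ι)) x)

/-- The even-parity majorant of `(A u)_ι`: `B^E_ι(z) := Σ_κ (Ξ^{[even],ι}(z+e_κ+e_ι) + μ Ξ^{[odd],−ι}(z+e_κ) + μ Ξ^{[odd],ι}(z+e_ι) + μ² Ξ^{[even],−ι}(z))`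
(the `Ξ^ι`-classes multiplying an even number of odd factors `μ`, `Π^{[odd]}`). [cite: FitznerVanDerHofstad2016NoBLE, App. D Step 5 (p. 1117), (D.32) lines 7–9] -/
def nobleMajBE (d : ℕ) (p : unitInterval) (i : BetaMap.Inputs) (ι : Fin d × Bool) (z : Site d) : ℝ :=
  ∑ κ : Fin d × Bool, (nobleXiIotaCls d p (fun N => 2 * N) (𝐞 ι) (z + 𝐞 κ + 𝐞 ι) +
    i.mu * nobleXiIotaCls d p (fun N => 2 * N + 1) (𝐞 (srev ι)) (z + 𝐞 κ) +
      i.mu * nobleXiIotaCls d p (fun N => 2 * N + 1) (𝐞 ι) (z + 𝐞 ι) +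
        i.mu ^ 2 * nobleXiIotaCls d p (fun N => 2 * N) (𝐞 (srev ι)) z)

/-- The odd-parity majorant of `(A u)_ι`: `B^O_ι(z) := Σ_κ (Ξ^{[odd],ι}(z+e_κ+e_ι) + μ Ξ^{[even],−ι}(z+e_κ) + μ Ξ^{[even],ι}(z+e_ι) + μ² Ξ^{[odd],−ι}(z))`.
[cite: FitznerVanDerHofstad2016NoBLE, App. D Step 5 (p. 1117), (D.32) lines 7–9] -/
def nobleMajBO (d : ℕ) (p : unitInterval) (i : BetaMap.Inputs) (ι : Fin d × Bool) (z : Site d) : ℝ :=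
  ∑ κ : Fin d × Bool, (nobleXiIotaCls d p (fun N => 2 * N + 1) (𝐞 ι) (z + 𝐞 κ + 𝐞 ι) +
    i.mu * nobleXiIotaCls d p (fun N => 2 * N) (𝐞 (srev ι)) (z + 𝐞 κ) +
      i.mu * nobleXiIotaCls d p (fun N => 2 * N) (𝐞 ι) (z + 𝐞 ι) +
        i.mu ^ 2 * nobleXiIotaCls d p (fun N => 2 * N + 1) (𝐞 (srev ι)) z)

/-- Majorant of term 6 (direction `ι`): `μ̄² (1−μ²)⁻² (Ξ^{[even]} ⋆ B^E_ι + Ξ^{[odd]} ⋆ B^O_ι)(x)` ((D.32) lines 7–9: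
even × even and odd × odd classes on the positive side). [cite: FitznerVanDerHofstad2016NoBLE, App. D (D.31)–(D.32) lines 7–9 (p. 1117)] -/
def nobleMajM6 (d : ℕ) (p : unitInterval) (i : BetaMap.Inputs) (ι : Fin d × Bool) (x : Site d) : ℝ :=
  i.mub ^ 2 * ((1 - i.mu ^ 2)⁻¹) ^ 2 *
    (lconv (nobleXiCls d p fun N => 2 * N) (nobleMajBE d p i ι) x +
      lconv (nobleXiCls d p fun N => 2 * N + 1) (nobleMajBO d p i ι) x)

/-- **The majorant `m`** of `(R_F)₋`: `m := M₁ + Σ_ι (M₂ + M₃ + M₄ + M₅ + M₆)_ι`. [cite: FitznerVanDerHofstad2016NoBLE, App. D Step 5 (D.30)–(D.32) (p. 1117)] -/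
def nobleMaj (S : NobleSplit d p) (i : BetaMap.Inputs) (x : Site d) : ℝ :=
  nobleMajM1 d p i x + ∑ ι : Fin d × Bool, (nobleMajM2 d p i ι x + nobleMajM3 S i ι x + nobleMajM4 S i ι x +
    nobleMajM5 d p i ι x + nobleMajM6 d p i ι x)

end Majorant

/-! ## Part F (module 3c-B). Mass-and-displacement bounds of the majorant ([NoBLE17] App. D Step 4, (D.32)) -/

section MajorantBounds

local notation "𝐞" => Literature.Probability.Percolation.stepVec

variable {p : unitInterval} {P X : ℝ} {i : BetaMap.Inputs} {S : NobleSplit d p}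

/-- [folklore] -/
theorem MomentBound.congr {f g : Site d → ℝ} {L W : ℝ} (h : MomentBound g L W) (hfg : ∀ x, g x = f x) :
    MomentBound f L W := by
  have e : g = f := funext hfg
  subst e
  exact h

/-- `δ_{0,·}`: mass `1`, displacement `0`. [folklore] -/
theorem momentBound_nobleDelta : MomentBound (nobleDelta : Site d → ℝ) 1 0 := by
  have hW : (fun x : Site d => euclidNorm x ^ 2 * nobleDelta x) = fun _ => 0 := by
    funext x
    unfold nobleDelta
    split_ifs with hx
    · simp [hx]
    · simp
  refine ⟨nobleDelta_nonneg, summable_nobleDelta, (tsum_nobleDelta (d := d)).le, ?_, ?_⟩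
  · rw [hW]; exact summable_zero
  · rw [hW, tsum_zero]

/-! ### The scalar constants of (D.6)–(D.8) and (D.29) -/

/-- `t := 2dμ̄ β^abs_{Ξ^ι}/(1−μ)` — the mass of the kernel majorant `B` ((D.7): "`tmp2`" of the notebook).
[cite: FitznerVanDerHofstad2016NoBLE, App. D (D.7)–(D.8) (pp. 1111–1112)] -/
def nobleMajT (d : ℕ) (i : BetaMap.Inputs) : ℝ := 2 * d * i.mub / (1 - i.mu) * i.xiIotaAbs

/-- `W_B := 2d μ̄ (1−μ²)⁻¹ (β^abs_{ΔΞ^ι,ι} + μ β^abs_{ΔΞ^ι,0})` — the displacement of `B`. [cite: FitznerVanDerHofstad2016NoBLE, App. D (D.29) (p. 1116)] -/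
def nobleMajWB (d : ℕ) (i : BetaMap.Inputs) : ℝ :=
  2 * d * (i.mub * (1 - i.mu ^ 2)⁻¹ * (i.xiIotaDeltaEi + i.mu * i.xiIotaDeltaZero))

/-- Mass of `τ₂ = Σ_{n≥2} T_n`: `(2d/(1−μ)) t²/(1−t)`. [cite: FitznerVanDerHofstad2016NoBLE, App. D (D.8) (p. 1112)] -/
def nobleMajA2 (d : ℕ) (i : BetaMap.Inputs) : ℝ := 2 * d / (1 - i.mu) * nobleMajT d i ^ 2 / (1 - nobleMajT d i)

/-- Displacement of `τ₂`: `W_B (2d/(1−μ)) (t/(1−t)² + t/(1−t)) + 2d(1−μ²)⁻¹ t · t/(1−t)` ((D.29)).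
[cite: FitznerVanDerHofstad2016NoBLE, App. D (D.29) (p. 1116), (D.32) lines 1–3 (p. 1117)] -/
def nobleMajW2 (d : ℕ) (i : BetaMap.Inputs) : ℝ :=
  nobleMajWB d i * (2 * d / (1 - i.mu)) * (nobleMajT d i / (1 - nobleMajT d i) ^ 2 + nobleMajT d i / (1 - nobleMajT d i)) +
    2 * d * (1 - i.mu ^ 2)⁻¹ * nobleMajT d i * (nobleMajT d i / (1 - nobleMajT d i))

variable (hsc : NobleScalarFacts d p i) (h43 : NobleAssumption43At d p S i)
include hsc

/-- `T₀`: mass `2d/(1−μ)`, displacement `2d(1−μ²)⁻¹`. [cite: FitznerVanDerHofstad2016NoBLE, App. D (D.6) (p. 1111)] -/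
theorem momentBound_nobleMajT0 : MomentBound (nobleMajT0 d i) (2 * d / (1 - i.mu)) (2 * d * (1 - i.mu ^ 2)⁻¹) := by
  have hδ := momentBound_nobleDelta (d := d)
  have hc : (0 : ℝ) ≤ 2 * d * i.mu := by have := hsc.imu_nonneg; positivity
  have h := ((hδ.sum_dir_comp_add_stepVec).add (hδ.const_mul hc)).const_mul hsc.ci_nonneg
  refine (h.congr fun x => rfl).mono (le_of_eq ?_) (le_of_eq (by ring))
  have h1 : 1 - i.mu ≠ 0 := (sub_pos.2 hsc.imu_lt_one).ne'
  have h3 : 1 - i.mu ^ 2 ≠ 0 := hsc.one_sub_imu_sq_pos.ne'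
  have h4 : 1 - i.mu ^ 2 = (1 - i.mu) * (1 + i.mu) := by ring
  field_simp
  rw [h4]
  ring

include h43

/-- `b_ι`: mass `μ̄(1−μ²)⁻¹(1+μ)β^abs_{Ξ^ι}`, displacement `μ̄(1−μ²)⁻¹(β_{ΔΞ^ι,ι} + μβ_{ΔΞ^ι,0})`. [cite: FitznerVanDerHofstad2016NoBLE, App. D (D.7), (D.29) (pp. 1111, 1116)] -/
theorem momentBound_nobleMajBDir (ι : Fin d × Bool) :
    MomentBound (nobleMajBDir d p i ι) (i.mub * (1 - i.mu ^ 2)⁻¹ * (i.xiIotaAbs + i.mu * i.xiIotaAbs))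
      (i.mub * (1 - i.mu ^ 2)⁻¹ * (i.xiIotaDeltaEi + i.mu * i.xiIotaDeltaZero)) :=
  ((((momentBound_xiIotaCls_abs_shift h43 ι).add
      ((momentBound_xiIotaCls_abs h43 (srev ι)).const_mul hsc.imu_nonneg)).const_mul
    (mul_nonneg hsc.imub_nonneg hsc.ci_nonneg))).congr fun _ => rfl

/-- `B`: mass `t`, displacement `W_B` ((D.7)). [cite: FitznerVanDerHofstad2016NoBLE, App. D (D.7)–(D.8), (D.29) (pp. 1111–1116)] -/
theorem momentBound_nobleMajB : MomentBound (nobleMajB d p i) (nobleMajT d i) (nobleMajWB d i) := by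
  refine ((MomentBound.sum_dir fun ι => momentBound_nobleMajBDir hsc h43 ι).congr fun _ => rfl).mono
    (le_of_eq ?_) (le_of_eq rfl)
  have h1 : 1 - i.mu ≠ 0 := (sub_pos.2 hsc.imu_lt_one).ne'
  have h3 : 1 - i.mu ^ 2 ≠ 0 := hsc.one_sub_imu_sq_pos.ne'
  have h4 : 1 - i.mu ^ 2 = (1 - i.mu) * (1 + i.mu) := by ring
  unfold nobleMajT
  field_simp
  rw [h4]
  ring

omit hsc h43 in
/-- `B` is totally rotationally symmetric (a direction sum of a transported family). [cite: FitznerVanDerHofstad2017, §3.5 (arXiv:1506.07977v2 p. 32; EJP pp. 29–30)] -/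
theorem isTRS_nobleMajB : IsTRS (nobleMajB d p i) := by
  have h := isTRS_sum_of_relabel
    (fun e y => i.mub * (1 - i.mu ^ 2)⁻¹ *
      (nobleXiIotaCls d p (fun N => N) e (y + e) + i.mu * nobleXiIotaCls d p (fun N => N) (-e) y))
    fun π ε e y => by
      simp only [← zdSignedPermIso_add, ← zdSignedPermIso_neg, nobleXiIotaCls_relabel]
  have e : (fun y => ∑ ι : Fin d × Bool, (fun e y => i.mub * (1 - i.mu ^ 2)⁻¹ *
      (nobleXiIotaCls d p (fun N => N) e (y + e) + i.mu * nobleXiIotaCls d p (fun N => N) (-e) y)) (𝐞 ι) y) =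
      nobleMajB d p i := by
    funext y
    simp only [nobleMajB, nobleMajBDir, stepVec_srev]
  rwa [e] at h

omit hsc h43 in
/-- `B` is even. [folklore] -/
theorem nobleMajB_neg (y : Site d) : nobleMajB d p i (-y) = nobleMajB d p i y := isTRS_nobleMajB.apply_neg y

/-- **`τ₂ = Σ_{n≥2} T_n`**: mass `a₀t²/(1−t)`, displacement (D.29). [cite: FitznerVanDerHofstad2016NoBLE, App. D (D.8) (p. 1112), (D.29) (p. 1116)] -/
theorem momentBound_nobleMajTau2 (ht1 : nobleMajT d i < 1) :
    MomentBound (nobleMajTau2 d p i) (nobleMajA2 d i) (nobleMajW2 d i) :=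
  (momentBound_titer_tail (momentBound_nobleMajB hsc h43) nobleMajB_neg (momentBound_nobleMajT0 hsc) ht1).congr
    fun _ => rfl

/-- **Term 1 majorant**: displacement `μW₂ + μβ_{μ̄/μ}(β^abs_{ΔΞ} A₂ + β^abs_Ξ W₂)` = lines 1–3 of (D.32).
[cite: FitznerVanDerHofstad2016NoBLE, App. D (D.29), (D.32) lines 1–3 (pp. 1116–1117)] -/
theorem momentBound_nobleMajM1 (ht1 : nobleMajT d i < 1) :
    MomentBound (nobleMajM1 d p i) (i.mu * nobleMajA2 d i + i.mu * i.mubOverMu * (i.xiAbs * nobleMajA2 d i))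
      (i.mu * nobleMajW2 d i + i.mu * i.mubOverMu * (i.xiDeltaAbs * nobleMajA2 d i + i.xiAbs * nobleMajW2 d i)) := by
  have hτ := momentBound_nobleMajTau2 hsc h43 ht1
  exact ((hτ.const_mul hsc.imu_nonneg).add
    (((momentBound_xiCls_abs h43).lconv (nobleXiCls_neg _) hτ).const_mul
      (mul_nonneg hsc.imu_nonneg hsc.q_nonneg))).congr fun _ => rfl

/-- **Term 2 majorant** (summed over `ι`): displacement `μβ_{μ̄/μ}(1−μ²)⁻¹ 2d(β_{ΔΞ,odd≥3} + β_{Ξ,odd≥3} + μβ_{ΔΞ,even≥2})`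
(the `β_{Ψ Ξ}` part of line 4 of (D.32)). [cite: FitznerVanDerHofstad2016NoBLE, App. D (D.32) line 4 (p. 1117)] -/
theorem momentBound_sum_nobleMajM2 : ∃ L, MomentBound (fun x => ∑ ι : Fin d × Bool, nobleMajM2 d p i ι x) L
    (i.mu * i.mubOverMu * (1 - i.mu ^ 2)⁻¹ *
      (2 * d * (i.xiOddTailDelta + i.xiOddTail) + i.mu * (2 * d * i.xiEvenTailDelta))) := by
  have hc : 0 ≤ i.mu * i.mubOverMu * (1 - i.mu ^ 2)⁻¹ :=
    mul_nonneg (mul_nonneg hsc.imu_nonneg hsc.q_nonneg) hsc.ci_nonneg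
  have h := (((momentBound_xiCls_oddTail h43).sum_dir_comp_add_stepVec).add
    ((MomentBound.sum_dir fun _ : Fin d × Bool => momentBound_xiCls_evenTail h43).const_mul hsc.imu_nonneg)).const_mul hc
  refine ⟨_, h.congr fun x => ?_⟩
  simp only [nobleMajM2, Finset.mul_sum, Finset.sum_add_distrib, mul_add]

/-- **Term 3 majorant** (direction `ι`): displacement `μ(1−μ²)⁻¹(β_{ΔΨ^{(1)}_{R,I}} + μβ_{ΔΨ^{(0)}_{R,II}})` (line 4 of (D.32)).
[cite: FitznerVanDerHofstad2016NoBLE, Assumption 4.3 (4.44)–(4.45) (p. 1087); App. D (D.32) line 4 (p. 1117)] -/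
theorem momentBound_nobleMajM3 (ι : Fin d × Bool) : MomentBound (nobleMajM3 S i ι)
    (i.mu * (1 - i.mu ^ 2)⁻¹ * (i.psiRI1 + i.mu * i.psiRII0))
    (i.mu * (1 - i.mu ^ 2)⁻¹ * (i.psiRI1Delta + i.mu * i.psiRII0Delta)) :=
  ((((momentBound_of_SumLE_shift (S.psiRI_nonneg le_rfl ι) (h43.psiRI1 ι) (𝐞 ι) (h43.psiRI1Delta ι)).add
      ((momentBound_of_SumLE (S.psiRII_nonneg zero_le_one ι) (h43.psiRII0 ι) (h43.psiRII0Delta ι)).const_mul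
        hsc.imu_nonneg)).const_mul (mul_nonneg hsc.imu_nonneg hsc.ci_nonneg))).congr fun _ => rfl

omit hsc in
/-- The shifted `Π`-remainder `x ↦ Σ_{ι,κ} Π^{(0),ι,κ}_R(x+e_ι+e_κ)`: mass `2dβ_{Π,R}`, displacement `β_{ΔΠ,R}` ((4.48)).
[cite: FitznerVanDerHofstad2016NoBLE, Assumption 4.3 (4.48) (p. 1088); App. D (D.32) line 5 (p. 1117)] -/
theorem momentBound_sum_piR_shift :
    MomentBound (fun x => ∑ ι : Fin d × Bool, ∑ κ : Fin d × Bool, S.piR ι κ (x + 𝐞 ι + 𝐞 κ)) (2 * d * i.piR0)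
      i.piR0DeltaEiEk := by
  have hs : ∀ ι κ, Summable fun x => S.piR ι κ (x + 𝐞 ι + 𝐞 κ) := fun ι κ => by
    simp only [add_assoc]
    exact (summable_comp_add_right_iff (𝐞 ι + 𝐞 κ)).2 ((h43.piR0 κ).1 ι)
  have ht : ∀ ι κ, ∑' x, S.piR ι κ (x + 𝐞 ι + 𝐞 κ) = ∑' x, S.piR ι κ x := fun ι κ => by
    simp only [add_assoc]
    exact tsum_comp_add_right' _ _
  refine ⟨fun x => Finset.sum_nonneg fun ι _ => Finset.sum_nonneg fun κ _ => S.piR_nonneg ι κ _,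
    summable_sum fun ι _ => summable_sum fun κ _ => hs ι κ, ?_, ?_, ?_⟩
  · rw [Summable.tsum_finsetSum fun ι _ => summable_sum fun κ _ => hs ι κ]
    simp only [Summable.tsum_finsetSum fun κ _ => hs _ κ, ht]
    rw [Finset.sum_comm, ← sum_const_dir d i.piR0]
    exact Finset.sum_le_sum fun κ _ => (h43.piR0 κ).2
  · simp only [Finset.mul_sum]
    exact summable_sum fun ι _ => summable_sum fun κ _ => h43.piR0DeltaEiEk.1 ι κ
  · simp only [Finset.mul_sum]
    rw [Summable.tsum_finsetSum fun ι _ => summable_sum fun κ _ => h43.piR0DeltaEiEk.1 ι κ]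
    simp only [Summable.tsum_finsetSum fun κ _ => h43.piR0DeltaEiEk.1 _ κ]
    exact h43.piR0DeltaEiEk.2

/-- **Term 4 majorant** (summed over `ι`): displacement `μ(1−μ²)⁻²(β_{ΔΠ,R} + (2d)²μ̄(β_{ΔΞ^ι,even≥2,ι} + β_{Ξ^ι,even≥2}))`
= line 5 of (D.32). [cite: FitznerVanDerHofstad2016NoBLE, App. D (D.32) line 5 (p. 1117)] -/
theorem momentBound_sum_nobleMajM4 : ∃ L, MomentBound (fun x => ∑ ι : Fin d × Bool, nobleMajM4 S i ι x) L
    (i.mu * ((1 - i.mu ^ 2)⁻¹) ^ 2 *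
      (i.piR0DeltaEiEk + i.mub * (2 * d * (2 * d * (i.xiIotaEvenTailDeltaEi + i.xiIotaEvenTail))))) := by
  have hY : ∀ ι : Fin d × Bool, MomentBound
      (fun x => ∑ κ : Fin d × Bool, nobleXiIotaCls d p (fun N => 2 * N + 2) (𝐞 ι) (x + 𝐞 κ + 𝐞 ι))
      (2 * d * i.xiIotaEvenTail) (2 * d * (i.xiIotaEvenTailDeltaEi + i.xiIotaEvenTail)) := fun ι =>
    ((momentBound_xiIotaCls_evenTail_shift h43 ι).sum_dir_comp_add_stepVec).congr fun _ => rfl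
  have h := ((momentBound_sum_piR_shift h43).add ((MomentBound.sum_dir hY).const_mul hsc.imub_nonneg)).const_mul
    (mul_nonneg hsc.imu_nonneg (sq_nonneg ((1 - i.mu ^ 2)⁻¹)))
  refine ⟨_, h.congr fun x => ?_⟩
  simp only [nobleMajM4, Finset.mul_sum, Finset.sum_add_distrib, mul_add]

/-- **Term 5 majorant** (direction `ι`): displacement `μ²μ̄(1−μ²)⁻² 2d(β_{ΔΞ^ι,odd,0} + β_{Ξ^ι,odd} + β_{ΔΞ^ι,odd,ι} + μβ_{ΔΞ^ι,even,0})`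
(line 6 of (D.32)). [cite: FitznerVanDerHofstad2016NoBLE, App. D (D.32) line 6 (p. 1117)] -/
theorem momentBound_nobleMajM5 (ι : Fin d × Bool) : MomentBound (nobleMajM5 d p i ι)
    (i.mu ^ 2 * i.mub * ((1 - i.mu ^ 2)⁻¹) ^ 2 *
      (2 * d * i.xiIotaOdd + 2 * d * i.xiIotaOdd + 2 * d * (i.mu * i.xiIotaEven)))
    (i.mu ^ 2 * i.mub * ((1 - i.mu ^ 2)⁻¹) ^ 2 *
      (2 * d * (i.xiIotaOddDeltaZero + i.xiIotaOdd) + 2 * d * i.xiIotaOddDeltaEi +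
        2 * d * (i.mu * i.xiIotaEvenDeltaZero))) := by
  have hc : 0 ≤ i.mu ^ 2 * i.mub * ((1 - i.mu ^ 2)⁻¹) ^ 2 :=
    mul_nonneg (mul_nonneg (sq_nonneg _) hsc.imub_nonneg) (sq_nonneg _)
  have h := ((((momentBound_xiIotaCls_odd h43 (srev ι)).sum_dir_comp_add_stepVec).add
    (MomentBound.sum_dir fun _ : Fin d × Bool => momentBound_xiIotaCls_odd_shift h43 ι)).add
    (MomentBound.sum_dir fun _ : Fin d × Bool => (momentBound_xiIotaCls_even h43 (srev ι)).const_mul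
      hsc.imu_nonneg)).const_mul hc
  refine h.congr fun x => ?_
  simp only [nobleMajM5, Finset.sum_add_distrib]

/-- `B^E_ι`: mass `2d((1+μ²)β_{Ξ^ι,even} + 2μβ_{Ξ^ι,odd})`, displacement
`2d(β_{ΔΞ^ι,even,ι} + β_{Ξ^ι,even} + μ(β_{ΔΞ^ι,odd,0} + β_{Ξ^ι,odd}) + μβ_{ΔΞ^ι,odd,ι} + μ²β_{ΔΞ^ι,even,0})`.
[cite: FitznerVanDerHofstad2016NoBLE, App. D Step 4 (D.28)–(D.29) (p. 1116), (D.32) lines 7–9 (p. 1117)] -/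
theorem momentBound_nobleMajBE (ι : Fin d × Bool) : MomentBound (nobleMajBE d p i ι)
    (2 * d * i.xiIotaEven + 2 * d * (i.mu * i.xiIotaOdd) + 2 * d * (i.mu * i.xiIotaOdd) +
      2 * d * (i.mu ^ 2 * i.xiIotaEven))
    (2 * d * (i.xiIotaEvenDeltaEi + i.xiIotaEven) + 2 * d * (i.mu * i.xiIotaOddDeltaZero + i.mu * i.xiIotaOdd) +
      2 * d * (i.mu * i.xiIotaOddDeltaEi) + 2 * d * (i.mu ^ 2 * i.xiIotaEvenDeltaZero)) := by
  have hmu2 : 0 ≤ i.mu ^ 2 := sq_nonneg _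
  have h := ((((momentBound_xiIotaCls_even_shift h43 ι).sum_dir_comp_add_stepVec).add
    (((momentBound_xiIotaCls_odd h43 (srev ι)).const_mul hsc.imu_nonneg).sum_dir_comp_add_stepVec)).add
    (MomentBound.sum_dir fun _ : Fin d × Bool => (momentBound_xiIotaCls_odd_shift h43 ι).const_mul
      hsc.imu_nonneg)).add
    (MomentBound.sum_dir fun _ : Fin d × Bool => (momentBound_xiIotaCls_even h43 (srev ι)).const_mul hmu2)
  refine h.congr fun x => ?_
  simp only [nobleMajBE, Finset.sum_add_distrib]

/-- `B^O_ι`: the same with even ↔ odd. [cite: FitznerVanDerHofstad2016NoBLE, App. D Step 4 (D.28)–(D.29) (p. 1116), (D.32) lines 7–9 (p. 1117)] -/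
theorem momentBound_nobleMajBO (ι : Fin d × Bool) : MomentBound (nobleMajBO d p i ι)
    (2 * d * i.xiIotaOdd + 2 * d * (i.mu * i.xiIotaEven) + 2 * d * (i.mu * i.xiIotaEven) +
      2 * d * (i.mu ^ 2 * i.xiIotaOdd))
    (2 * d * (i.xiIotaOddDeltaEi + i.xiIotaOdd) + 2 * d * (i.mu * i.xiIotaEvenDeltaZero + i.mu * i.xiIotaEven) +
      2 * d * (i.mu * i.xiIotaEvenDeltaEi) + 2 * d * (i.mu ^ 2 * i.xiIotaOddDeltaZero)) := by
  have hmu2 : 0 ≤ i.mu ^ 2 := sq_nonneg _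
  have h := ((((momentBound_xiIotaCls_odd_shift h43 ι).sum_dir_comp_add_stepVec).add
    (((momentBound_xiIotaCls_even h43 (srev ι)).const_mul hsc.imu_nonneg).sum_dir_comp_add_stepVec)).add
    (MomentBound.sum_dir fun _ : Fin d × Bool => (momentBound_xiIotaCls_even_shift h43 ι).const_mul
      hsc.imu_nonneg)).add
    (MomentBound.sum_dir fun _ : Fin d × Bool => (momentBound_xiIotaCls_odd h43 (srev ι)).const_mul hmu2)
  refine h.congr fun x => ?_
  simp only [nobleMajBO, Finset.sum_add_distrib]

/-- **Term 6 majorant** (direction `ι`): `μ̄²(1−μ²)⁻²(Ξ^{[even]} ⋆ B^E_ι + Ξ^{[odd]} ⋆ B^O_ι)` — displacement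
`μ̄²(1−μ²)⁻²(β_{ΔΞ,even} L(B^E) + β_{Ξ,even} W(B^E) + β_{ΔΞ,odd} L(B^O) + β_{Ξ,odd} W(B^O))` = lines 7–9 of (D.32) / `2d`.
[cite: FitznerVanDerHofstad2016NoBLE, App. D (D.25)–(D.28) (p. 1116), (D.31)–(D.32) lines 7–9 (p. 1117)] -/
theorem momentBound_nobleMajM6 (ι : Fin d × Bool) : MomentBound (nobleMajM6 d p i ι)
    (i.mub ^ 2 * ((1 - i.mu ^ 2)⁻¹) ^ 2 *
      (i.xiEven * (2 * d * i.xiIotaEven + 2 * d * (i.mu * i.xiIotaOdd) + 2 * d * (i.mu * i.xiIotaOdd) +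
          2 * d * (i.mu ^ 2 * i.xiIotaEven)) +
        i.xiOdd * (2 * d * i.xiIotaOdd + 2 * d * (i.mu * i.xiIotaEven) + 2 * d * (i.mu * i.xiIotaEven) +
          2 * d * (i.mu ^ 2 * i.xiIotaOdd))))
    (i.mub ^ 2 * ((1 - i.mu ^ 2)⁻¹) ^ 2 *
      ((i.xiEvenDelta * (2 * d * i.xiIotaEven + 2 * d * (i.mu * i.xiIotaOdd) + 2 * d * (i.mu * i.xiIotaOdd) +
            2 * d * (i.mu ^ 2 * i.xiIotaEven)) +
          i.xiEven * (2 * d * (i.xiIotaEvenDeltaEi + i.xiIotaEven) +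
            2 * d * (i.mu * i.xiIotaOddDeltaZero + i.mu * i.xiIotaOdd) + 2 * d * (i.mu * i.xiIotaOddDeltaEi) +
              2 * d * (i.mu ^ 2 * i.xiIotaEvenDeltaZero))) +
        (i.xiOddDelta * (2 * d * i.xiIotaOdd + 2 * d * (i.mu * i.xiIotaEven) + 2 * d * (i.mu * i.xiIotaEven) +
            2 * d * (i.mu ^ 2 * i.xiIotaOdd)) +
          i.xiOdd * (2 * d * (i.xiIotaOddDeltaEi + i.xiIotaOdd) +
            2 * d * (i.mu * i.xiIotaEvenDeltaZero + i.mu * i.xiIotaEven) + 2 * d * (i.mu * i.xiIotaEvenDeltaEi) +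
              2 * d * (i.mu ^ 2 * i.xiIotaOddDeltaZero))))) :=
  ((((momentBound_xiCls_even h43).lconv (nobleXiCls_neg _) (momentBound_nobleMajBE hsc h43 ι)).add
      ((momentBound_xiCls_odd h43).lconv (nobleXiCls_neg _) (momentBound_nobleMajBO hsc h43 ι))).const_mul
    (mul_nonneg (sq_nonneg _) (sq_nonneg _))).congr fun _ => rfl

omit hsc h43 in
/-- **The displacement constant the bookkeeping yields**: with the constants of the six term majorants summed,
`Σ_x ‖x‖₂² m(x) ≤ β^{corr}_{ΔR,F}(i)` — the value of `BetaMap.betaRfDeltaCorr` at the record `i`.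
[cite: FitznerVanDerHofstad2016NoBLE, App. D Step 5 (D.32) (p. 1117)] -/
theorem nobleMajW_eq :
    i.mu * nobleMajW2 d i + i.mu * i.mubOverMu * (i.xiDeltaAbs * nobleMajA2 d i + i.xiAbs * nobleMajW2 d i) +
      (i.mu * i.mubOverMu * (1 - i.mu ^ 2)⁻¹ *
          (2 * d * (i.xiOddTailDelta + i.xiOddTail) + i.mu * (2 * d * i.xiEvenTailDelta)) +
        2 * d * (i.mu * (1 - i.mu ^ 2)⁻¹ * (i.psiRI1Delta + i.mu * i.psiRII0Delta)) +
        i.mu * ((1 - i.mu ^ 2)⁻¹) ^ 2 *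
          (i.piR0DeltaEiEk + i.mub * (2 * d * (2 * d * (i.xiIotaEvenTailDeltaEi + i.xiIotaEvenTail)))) +
        2 * d * (i.mu ^ 2 * i.mub * ((1 - i.mu ^ 2)⁻¹) ^ 2 *
          (2 * d * (i.xiIotaOddDeltaZero + i.xiIotaOdd) + 2 * d * i.xiIotaOddDeltaEi +
            2 * d * (i.mu * i.xiIotaEvenDeltaZero))) +
        2 * d * (i.mub ^ 2 * ((1 - i.mu ^ 2)⁻¹) ^ 2 *
          ((i.xiEvenDelta * (2 * d * i.xiIotaEven + 2 * d * (i.mu * i.xiIotaOdd) + 2 * d * (i.mu * i.xiIotaOdd) +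
                2 * d * (i.mu ^ 2 * i.xiIotaEven)) +
              i.xiEven * (2 * d * (i.xiIotaEvenDeltaEi + i.xiIotaEven) +
                2 * d * (i.mu * i.xiIotaOddDeltaZero + i.mu * i.xiIotaOdd) + 2 * d * (i.mu * i.xiIotaOddDeltaEi) +
                  2 * d * (i.mu ^ 2 * i.xiIotaEvenDeltaZero))) +
            (i.xiOddDelta * (2 * d * i.xiIotaOdd + 2 * d * (i.mu * i.xiIotaEven) + 2 * d * (i.mu * i.xiIotaEven) +
                2 * d * (i.mu ^ 2 * i.xiIotaOdd)) +
              i.xiOdd * (2 * d * (i.xiIotaOddDeltaEi + i.xiIotaOdd) +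
                2 * d * (i.mu * i.xiIotaEvenDeltaZero + i.mu * i.xiIotaEven) + 2 * d * (i.mu * i.xiIotaEvenDeltaEi) +
                  2 * d * (i.mu ^ 2 * i.xiIotaOddDeltaZero)))))) =
      BetaMap.betaRfDeltaCorr (d : ℝ) i.mu i.mubOverMu i.mub i.xiAbs i.xiOdd i.xiEven i.xiDeltaAbs i.xiOddDelta
        i.xiEvenDelta i.xiOddTail i.xiOddTailDelta i.xiEvenTailDelta i.psiRI1Delta i.psiRII0Delta i.xiIotaAbs
        i.xiIotaOdd i.xiIotaEven i.xiIotaDeltaEi i.xiIotaOddDeltaEi i.xiIotaEvenDeltaEi i.xiIotaDeltaZero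
        i.xiIotaOddDeltaZero i.xiIotaEvenDeltaZero i.xiIotaEvenTail i.xiIotaEvenTailDeltaEi i.piR0DeltaEiEk := by
  simp only [BetaMap.betaRfDeltaCorr, nobleMajW2, nobleMajA2, nobleMajWB, nobleMajT]
  simp only [div_eq_mul_inv, mul_inv, ← inv_pow]
  ring

end MajorantBounds

/-! ## Part F2. Pointwise domination `−m ≤ R_F` ([NoBLE17] App. D Step 4, (D.30)–(D.31)) -/

section MajorantPointwise

local notation "𝐞" => Literature.Probability.Percolation.stepVec

variable {p : unitInterval} {P X : ℝ} {i : BetaMap.Inputs} {S : NobleSplit d p}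

/-- Bookkeeping: `T = A − B`, `A ≥ 0`, `B ≤ M` give `−M ≤ T`. [folklore] -/
theorem neg_le_of_parts {T A B M : ℝ} (hT : T = A - B) (hA : 0 ≤ A) (hB : B ≤ M) : -M ≤ T := by
  rw [hT]; linarith

variable (hd : 2 ≤ d) (hp : p < criticalProbI d) (hsc : NobleScalarFacts d p i) (h43 : NobleAssumption43At d p S i)

include hsc in
/-- `Σ_ι |u_ι(x)| ≤ T₀(x)` ((D.6)). [cite: FitznerVanDerHofstad2016NoBLE, App. D (D.6) (p. 1111)] -/
theorem sum_abs_nobleSeedU_le_majT0 (x : Site d) : ∑ ι, |nobleSeedU d p ι x| ≤ nobleMajT0 d i x := by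
  have hc := hsc.c_nonneg
  have hμ0 := hsc.mu_nonneg
  calc ∑ ι, |nobleSeedU d p ι x|
      ≤ ∑ ι, (1 - nobleMu d p ^ 2)⁻¹ * (nobleDelta (x + 𝐞 ι) + nobleMu d p * nobleDelta x) :=
        Finset.sum_le_sum fun ι _ => by
          rw [nobleSeedU, abs_mul, abs_of_nonneg hc]
          refine mul_le_mul_of_nonneg_left ((abs_sub _ _).trans (le_of_eq ?_)) hc
          rw [abs_of_nonneg (nobleDelta_nonneg _), abs_mul, abs_of_nonneg hμ0,
            abs_of_nonneg (nobleDelta_nonneg _)]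
    _ = (1 - nobleMu d p ^ 2)⁻¹ * ((∑ ι, nobleDelta (x + 𝐞 ι)) + 2 * d * nobleMu d p * nobleDelta x) := by
        rw [← Finset.mul_sum, Finset.sum_add_distrib, sum_const_dir]; ring
    _ ≤ nobleMajT0 d i x := by
        unfold nobleMajT0
        have hδ := nobleDelta_nonneg x
        have hS : 0 ≤ ∑ ι, nobleDelta (x + 𝐞 ι) := Finset.sum_nonneg fun ι _ => nobleDelta_nonneg _
        have h1 : 2 * (d : ℝ) * nobleMu d p * nobleDelta x ≤ 2 * d * i.mu * nobleDelta x :=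
          mul_le_mul_of_nonneg_right (mul_le_mul_of_nonneg_left hsc.mu_le (by positivity)) hδ
        have h2 : 0 ≤ 2 * (d : ℝ) * nobleMu d p * nobleDelta x := by positivity
        exact mul_le_mul hsc.c_le (add_le_add le_rfl h1) (add_nonneg hS h2) hsc.ci_nonneg

include hd hp hsc h43

/-- `|A^{ι,κ}(y)| ≤ b_ι(y)` ((D.7)). [cite: FitznerVanDerHofstad2016NoBLE, App. D (D.7) (p. 1111); Assumption 4.3 (4.42)] -/
theorem abs_nobleKer_le_majBDir (ι κ : Fin d × Bool) (y : Site d) : |nobleKer d p ι κ y| ≤ nobleMajBDir d p i ι y := by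
  have hc := hsc.c_nonneg
  have hμ0 := hsc.mu_nonneg
  have hY1 := nobleXiIotaCls_nonneg (p := p) (fun N => N) (𝐞 ι) (y + 𝐞 ι)
  have hY2 := nobleXiIotaCls_nonneg (p := p) (fun N => N) (𝐞 (srev ι)) y
  have h1 := abs_noblePi_le hd hp h43 ι κ (y + 𝐞 ι)
  have h2 := abs_noblePi_le hd hp h43 (srev ι) κ y
  calc |nobleKer d p ι κ y|
      ≤ (1 - nobleMu d p ^ 2)⁻¹ * ((p : ℝ) * nobleXiIotaCls d p (fun N => N) (𝐞 ι) (y + 𝐞 ι) +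
          nobleMu d p * ((p : ℝ) * nobleXiIotaCls d p (fun N => N) (𝐞 (srev ι)) y)) := by
        rw [nobleKer, abs_mul, abs_of_nonneg hc]
        refine mul_le_mul_of_nonneg_left ((abs_sub _ _).trans (add_le_add h1 ?_)) hc
        rw [abs_mul, abs_of_nonneg hμ0]
        exact mul_le_mul_of_nonneg_left h2 hμ0
    _ = (p : ℝ) * (1 - nobleMu d p ^ 2)⁻¹ * (nobleXiIotaCls d p (fun N => N) (𝐞 ι) (y + 𝐞 ι) +
          nobleMu d p * nobleXiIotaCls d p (fun N => N) (𝐞 (srev ι)) y) := by ring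
    _ ≤ nobleMajBDir d p i ι y := by
        unfold nobleMajBDir
        exact mul_le_mul (mul_le_mul hsc.pbar_le hsc.c_le hc hsc.imub_nonneg)
          (add_le_add le_rfl (mul_le_mul_of_nonneg_right hsc.mu_le hY2))
          (add_nonneg hY1 (mul_nonneg hμ0 hY2)) (mul_nonneg hsc.imub_nonneg hsc.ci_nonneg)

omit hd hp in
/-- The iterates `T_n` of the majorant are summable in `n` at each point (geometric decay of the masses). [folklore] -/
theorem summable_titer_nobleMaj (ht1 : nobleMajT d i < 1) (x : Site d) :
    Summable fun n => titer (nobleMajB d p i) (nobleMajT0 d i) (n + 2) x := by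
  have hB := momentBound_nobleMajB hsc h43
  have h0 := momentBound_nobleMajT0 hsc
  have hn := momentBound_titer hB nobleMajB_neg h0
  refine Summable.of_nonneg_of_le (fun n => (hn (n + 2)).nonneg x) (fun n => (hn (n + 2)).apply_le x) ?_
  exact (tsum_pow_add_two_mul hB.L_nonneg ht1 _).1

/-- **`Σ_ι |T²_ι(x)| ≤ τ₂(x)`**: the Neumann tail is dominated by the iterated majorant ((D.8), (D.29)).
[cite: FitznerVanDerHofstad2016NoBLE, App. D (D.6)–(D.8) (pp. 1111–1112), (D.29) (p. 1116)] -/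
theorem sum_abs_nobleSTail2_le_majTau2 [NeZero d] (h : NobleL1At d p P X) (ht1 : nobleMajT d i < 1) (x : Site d) :
    ∑ ι, |nobleSTail2 d p ι x| ≤ nobleMajTau2 d p i x := by
  have hB := momentBound_nobleMajB hsc h43
  have h0 := momentBound_nobleMajT0 hsc
  have hn := momentBound_titer hB nobleMajB_neg h0
  have hb := momentBound_nobleMajBDir hsc h43
  have hι : ∀ ι, Summable fun n => |kiter (nobleKer d p) (nobleSeedU d p) (n + 2) ι x| := fun ι =>
    (summable_nat_add_iff (f := fun n => |kiter (nobleKer d p) (nobleSeedU d p) n ι x|) 2).2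
      (summable_abs_kiter_nobleS h ι x)
  have hk : ∀ n y, ∑ ι, |kiter (nobleKer d p) (nobleSeedU d p) n ι y| ≤ titer (nobleMajB d p i) (nobleMajT0 d i) n y :=
    sum_abs_kiter_le_titer (summable_abs_nobleKer h) (summable_abs_nobleSeedU p) (fun ι y => (hb ι).nonneg y)
      (fun ι => (hb ι).summable) (abs_nobleKer_le_majBDir hd hp hsc h43) (sum_abs_nobleSeedU_le_majT0 hsc)
      (fun n y => (hn n).nonneg y) fun n => (hn n).summable
  calc ∑ ι, |nobleSTail2 d p ι x| ≤ ∑ ι, ∑' n, |kiter (nobleKer d p) (nobleSeedU d p) (n + 2) ι x| :=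
        Finset.sum_le_sum fun ι _ => abs_nobleSTail2_le h ι x
    _ = ∑' n, ∑ ι, |kiter (nobleKer d p) (nobleSeedU d p) (n + 2) ι x| :=
        (Summable.tsum_finsetSum fun ι _ => hι ι).symm
    _ ≤ nobleMajTau2 d p i x :=
        Summable.tsum_le_tsum (fun n => hk (n + 2) x) (summable_sum fun ι _ => hι ι)
          (summable_titer_nobleMaj hsc h43 ht1 x)

omit hd hp in
/-- `τ₂ ≥ 0`. [folklore] -/
theorem nobleMajTau2_nonneg (ht1 : nobleMajT d i < 1) (x : Site d) : 0 ≤ nobleMajTau2 d p i x :=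
  (momentBound_nobleMajTau2 hsc h43 ht1).nonneg x

/-- **Term 1**: `−M₁(x) ≤ Σ_ι μ(T²_ι + Ψ^ι ⋆ T²_ι)(x)` ((D.31) first line, (D.32) lines 1–3).
[cite: FitznerVanDerHofstad2016NoBLE, App. D (D.29)–(D.32) (pp. 1116–1117)] -/
theorem neg_nobleMajM1_le [NeZero d] (h : NobleL1At d p P X) (ht1 : nobleMajT d i < 1) (x : Site d) :
    -nobleMajM1 d p i x ≤ ∑ ι, nobleFRemT1 d p ι x := by
  have hμ0 := hsc.mu_nonneg
  have hq0 := hsc.qp_nonneg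
  have hτ := momentBound_nobleMajTau2 hsc h43 ht1
  have hXA := momentBound_xiCls_abs h43
  have hXq : Summable fun y => (p : ℝ) / nobleMu d p * nobleXiCls d p (fun N => N) y := hXA.summable.mul_left _
  have htail := sum_abs_nobleSTail2_le_majTau2 hd hp hsc h43 h ht1
  -- |Ψ^ι ⋆ T²_ι| ≤ (q Ξ^{[abs]}) ⋆ |T²_ι|
  have hconv : ∀ ι, |lconv (noblePsi d p ι) (nobleSTail2 d p ι) x| ≤
      lconv (fun y => (p : ℝ) / nobleMu d p * nobleXiCls d p (fun N => N) y) (fun y => |nobleSTail2 d p ι y|) x :=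
    fun ι => abs_lconv_le_lconv (abs_noblePsi_le hd hp h43 ι) (fun y => le_rfl) hXq
      (summable_abs_nobleSTail2 h ι) x
  have hsum : ∑ ι, lconv (fun y => (p : ℝ) / nobleMu d p * nobleXiCls d p (fun N => N) y)
        (fun y => |nobleSTail2 d p ι y|) x =
      lconv (fun y => (p : ℝ) / nobleMu d p * nobleXiCls d p (fun N => N) y)
        (fun y => ∑ ι, |nobleSTail2 d p ι y|) x :=
    (lconv_finset_sum_right _ _ (fun ι y => |nobleSTail2 d p ι y|) x fun ι _ =>
      summable_mul_shift_of_abs_le (f := fun y => (p : ℝ) / nobleMu d p * nobleXiCls d p (fun N => N) y)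
        (g := fun y => |nobleSTail2 d p ι y|) hXq.abs
        (abs_le_tsum_of_nonneg (fun _ => abs_nonneg _) (summable_abs_nobleSTail2 h ι)) x).symm
  have hmono : lconv (fun y => (p : ℝ) / nobleMu d p * nobleXiCls d p (fun N => N) y)
        (fun y => ∑ ι, |nobleSTail2 d p ι y|) x ≤
      (p : ℝ) / nobleMu d p * lconv (nobleXiCls d p fun N => N) (nobleMajTau2 d p i) x := by
    rw [← lconv_const_mul_left]
    exact lconv_mono (fun y => mul_nonneg hq0 (nobleXiCls_nonneg _ y)) (fun y => le_rfl)
      (fun y => Finset.sum_nonneg fun ι _ => abs_nonneg _) htail hXq hτ.summable x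
  have hL0 : 0 ≤ lconv (nobleXiCls d p fun N => N) (nobleMajTau2 d p i) x :=
    lconv_nonneg (nobleXiCls_nonneg _) hτ.nonneg x
  have hper : ∀ ι, -(nobleMu d p * (|nobleSTail2 d p ι x| +
      lconv (fun y => (p : ℝ) / nobleMu d p * nobleXiCls d p (fun N => N) y) (fun y => |nobleSTail2 d p ι y|) x)) ≤
      nobleFRemT1 d p ι x := fun ι => by
    rw [nobleFRemT1, ← mul_neg]
    refine mul_le_mul_of_nonneg_left ?_ hμ0
    rw [neg_add]
    exact add_le_add (neg_abs_le _) ((neg_le_neg (hconv ι)).trans (neg_abs_le _))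
  calc -nobleMajM1 d p i x
      ≤ -(nobleMu d p * (nobleMajTau2 d p i x +
          (p : ℝ) / nobleMu d p * lconv (nobleXiCls d p fun N => N) (nobleMajTau2 d p i) x)) := by
        rw [nobleMajM1, neg_le_neg_iff, mul_add, ← mul_assoc]
        exact add_le_add (mul_le_mul_of_nonneg_right hsc.mu_le (hτ.nonneg x))
          (mul_le_mul_of_nonneg_right hsc.mu_qp_le hL0)
    _ ≤ -(nobleMu d p * (∑ ι, |nobleSTail2 d p ι x| + ∑ ι, lconv
          (fun y => (p : ℝ) / nobleMu d p * nobleXiCls d p (fun N => N) y) (fun y => |nobleSTail2 d p ι y|) x)) := by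
        rw [neg_le_neg_iff, hsum]
        exact mul_le_mul_of_nonneg_left (add_le_add (htail x) hmono) hμ0
    _ = ∑ ι, -(nobleMu d p * (|nobleSTail2 d p ι x| +
          lconv (fun y => (p : ℝ) / nobleMu d p * nobleXiCls d p (fun N => N) y) (fun y => |nobleSTail2 d p ι y|) x)) := by
        rw [← Finset.sum_add_distrib, Finset.mul_sum, ← Finset.sum_neg_distrib]
    _ ≤ ∑ ι, nobleFRemT1 d p ι x := Finset.sum_le_sum fun ι _ => hper ι

/-- **Term 2**: `−M₂,ι(x) ≤ μc(ΨT_ι(x+e_ι) − μΨT_ι(x))` ((D.32) line 4, `β_{ΨΞ}`-part).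
[cite: FitznerVanDerHofstad2016NoBLE, App. D (D.30)–(D.32) line 4 (p. 1117)] -/
theorem neg_nobleMajM2_le (ι : Fin d × Bool) (x : Site d) : -nobleMajM2 d p i ι x ≤ nobleFRemT2 d p ι x := by
  have hμ0 := hsc.mu_nonneg
  have hc := hsc.c_nonneg
  have hq0 := hsc.qp_nonneg
  have hE' := noblePsiCls_nonneg (p := p) (fun N => 2 * N + 2) (𝐞 ι) (x + 𝐞 ι)
  have hO := noblePsiCls_nonneg (p := p) (fun N => 2 * N + 3) (𝐞 ι) x
  have hO' := noblePsiCls_nonneg (p := p) (fun N => 2 * N + 3) (𝐞 ι) (x + 𝐞 ι)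
  have hE := noblePsiCls_nonneg (p := p) (fun N => 2 * N + 2) (𝐞 ι) x
  have hXO' := nobleXiCls_nonneg (p := p) (fun N => 2 * N + 3) (x + 𝐞 ι)
  have hXE := nobleXiCls_nonneg (p := p) (fun N => 2 * N + 2) x
  have hbO := (noblePsiCls_le hd hp h43.xiOddTail ι (x + 𝐞 ι)).2
  have hbE := (noblePsiCls_le hd hp h43.xiEvenTail ι x).2
  refine neg_le_of_parts (A := nobleMu d p * (1 - nobleMu d p ^ 2)⁻¹ *
      noblePsiCls d p (fun N => 2 * N + 2) (𝐞 ι) (x + 𝐞 ι) +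
    nobleMu d p * nobleMu d p * (1 - nobleMu d p ^ 2)⁻¹ * noblePsiCls d p (fun N => 2 * N + 3) (𝐞 ι) x)
    (B := nobleMu d p * (1 - nobleMu d p ^ 2)⁻¹ *
      (noblePsiCls d p (fun N => 2 * N + 3) (𝐞 ι) (x + 𝐞 ι) + nobleMu d p * noblePsiCls d p (fun N => 2 * N + 2) (𝐞 ι) x))
    (by unfold nobleFRemT2 noblePsiTail2; ring)
    (add_nonneg (mul_nonneg (mul_nonneg hμ0 hc) hE') (mul_nonneg (mul_nonneg (mul_nonneg hμ0 hμ0) hc) hO)) ?_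
  calc nobleMu d p * (1 - nobleMu d p ^ 2)⁻¹ *
        (noblePsiCls d p (fun N => 2 * N + 3) (𝐞 ι) (x + 𝐞 ι) + nobleMu d p * noblePsiCls d p (fun N => 2 * N + 2) (𝐞 ι) x)
      ≤ nobleMu d p * (1 - nobleMu d p ^ 2)⁻¹ *
        ((p : ℝ) / nobleMu d p * nobleXiCls d p (fun N => 2 * N + 3) (x + 𝐞 ι) +
          nobleMu d p * ((p : ℝ) / nobleMu d p * nobleXiCls d p (fun N => 2 * N + 2) x)) :=
        mul_le_mul_of_nonneg_left (add_le_add hbO (mul_le_mul_of_nonneg_left hbE hμ0)) (mul_nonneg hμ0 hc)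
    _ = nobleMu d p * ((p : ℝ) / nobleMu d p) * (1 - nobleMu d p ^ 2)⁻¹ *
        (nobleXiCls d p (fun N => 2 * N + 3) (x + 𝐞 ι) + nobleMu d p * nobleXiCls d p (fun N => 2 * N + 2) x) := by ring
    _ ≤ i.mu * i.mubOverMu * (1 - i.mu ^ 2)⁻¹ *
        (nobleXiCls d p (fun N => 2 * N + 3) (x + 𝐞 ι) + i.mu * nobleXiCls d p (fun N => 2 * N + 2) x) :=
        mul_le_mul (mul_le_mul hsc.mu_qp_le hsc.c_le hc
          (mul_nonneg hsc.imu_nonneg hsc.q_nonneg))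
          (add_le_add le_rfl (mul_le_mul_of_nonneg_right hsc.mu_le hXE)) (add_nonneg hXO' (mul_nonneg hμ0 hXE))
          (mul_nonneg (mul_nonneg hsc.imu_nonneg hsc.q_nonneg) hsc.ci_nonneg)
    _ = nobleMajM2 d p i ι x := by unfold nobleMajM2; ring

omit hd hp h43 in
/-- **Term 3**: `−M₃,ι(x) ≤ μc((Ψ^{(0)}_{R,I} − Ψ^{(1)}_{R,I})(x+e_ι) − μ(Ψ^{(0)}_{R,II} − Ψ^{(1)}_{R,II})(x))` ((D.32) line 4).
[cite: FitznerVanDerHofstad2016NoBLE, App. D (D.30), (D.32) line 4 (p. 1117); Assumption 4.3 (4.44)–(4.45)] -/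
theorem neg_nobleMajM3_le (ι : Fin d × Bool) (x : Site d) : -nobleMajM3 S i ι x ≤ nobleFRemT3 S ι x := by
  have hμ0 := hsc.mu_nonneg
  have hc := hsc.c_nonneg
  have h0' := S.psiRI_nonneg zero_le_one ι (x + 𝐞 ι)
  have h1' := S.psiRI_nonneg le_rfl ι (x + 𝐞 ι)
  have h0 := S.psiRII_nonneg zero_le_one ι x
  have h1 := S.psiRII_nonneg le_rfl ι x
  refine neg_le_of_parts
    (A := nobleMu d p * (1 - nobleMu d p ^ 2)⁻¹ * S.psiRI 0 ι (x + 𝐞 ι) +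
      nobleMu d p * nobleMu d p * (1 - nobleMu d p ^ 2)⁻¹ * S.psiRII 1 ι x)
    (B := nobleMu d p * (1 - nobleMu d p ^ 2)⁻¹ * (S.psiRI 1 ι (x + 𝐞 ι) + nobleMu d p * S.psiRII 0 ι x))
    (by unfold nobleFRemT3; ring)
    (add_nonneg (mul_nonneg (mul_nonneg hμ0 hc) h0') (mul_nonneg (mul_nonneg (mul_nonneg hμ0 hμ0) hc) h1)) ?_
  unfold nobleMajM3
  exact mul_le_mul hsc.mu_c_le (add_le_add le_rfl (mul_le_mul_of_nonneg_right hsc.mu_le h0))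
    (add_nonneg h1' (mul_nonneg hμ0 h0)) (mul_nonneg hsc.imu_nonneg hsc.ci_nonneg)


/-- **Term 4**: `−M₄,ι(x) ≤ −μc² Σ_κ (Π^{(0),ι,κ}_R − ΠT_{ι,κ})(x+e_ι+e_κ)` ((D.32) line 5).
[cite: FitznerVanDerHofstad2016NoBLE, App. D (D.30)–(D.32) line 5 (p. 1117); Assumption 4.3 (4.48)] -/
theorem neg_nobleMajM4_le (ι : Fin d × Bool) (x : Site d) : -nobleMajM4 S i ι x ≤ nobleFRemT4 S ι x := by
  have hμ0 := hsc.mu_nonneg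
  have hc2 : 0 ≤ ((1 - nobleMu d p ^ 2)⁻¹) ^ 2 := sq_nonneg _
  have hp0 := hsc.pbar_nonneg
  have hO1 : ∀ κ, 0 ≤ noblePiCls d p (fun N => 2 * N + 1) (𝐞 ι) (𝐞 κ) (x + 𝐞 ι + 𝐞 κ) := fun κ =>
    noblePiCls_nonneg _ _ _ _
  have hR : ∀ κ, 0 ≤ S.piR ι κ (x + 𝐞 ι + 𝐞 κ) := fun κ => S.piR_nonneg ι κ _
  have hY : ∀ κ, 0 ≤ nobleXiIotaCls d p (fun N => 2 * N + 2) (𝐞 ι) (x + 𝐞 κ + 𝐞 ι) := fun κ =>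
    nobleXiIotaCls_nonneg _ _ _
  have hE2 : ∀ κ, noblePiCls d p (fun N => 2 * N + 2) (𝐞 ι) (𝐞 κ) (x + 𝐞 ι + 𝐞 κ) ≤
      (p : ℝ) * nobleXiIotaCls d p (fun N => 2 * N + 2) (𝐞 ι) (x + 𝐞 κ + 𝐞 ι) := fun κ => by
    have h := (noblePiCls_le hd hp ι (h43.xiIotaEvenTail ι) κ (x + 𝐞 ι + 𝐞 κ)).2
    rwa [add_right_comm x (𝐞 ι) (𝐞 κ)] at h ⊢
  refine neg_le_of_parts
    (A := nobleMu d p * ((1 - nobleMu d p ^ 2)⁻¹) ^ 2 *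
      ∑ κ : Fin d × Bool, noblePiCls d p (fun N => 2 * N + 1) (𝐞 ι) (𝐞 κ) (x + 𝐞 ι + 𝐞 κ))
    (B := nobleMu d p * ((1 - nobleMu d p ^ 2)⁻¹) ^ 2 *
      ∑ κ : Fin d × Bool, (S.piR ι κ (x + 𝐞 ι + 𝐞 κ) + noblePiCls d p (fun N => 2 * N + 2) (𝐞 ι) (𝐞 κ) (x + 𝐞 ι + 𝐞 κ)))
    (by unfold nobleFRemT4 noblePiTail1; simp only [Finset.sum_add_distrib, Finset.sum_sub_distrib]; ring)
    (mul_nonneg (mul_nonneg hμ0 hc2) (Finset.sum_nonneg fun κ _ => hO1 κ)) ?_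
  calc nobleMu d p * ((1 - nobleMu d p ^ 2)⁻¹) ^ 2 *
        ∑ κ : Fin d × Bool, (S.piR ι κ (x + 𝐞 ι + 𝐞 κ) + noblePiCls d p (fun N => 2 * N + 2) (𝐞 ι) (𝐞 κ) (x + 𝐞 ι + 𝐞 κ))
      ≤ nobleMu d p * ((1 - nobleMu d p ^ 2)⁻¹) ^ 2 *
        ((∑ κ : Fin d × Bool, S.piR ι κ (x + 𝐞 ι + 𝐞 κ)) +
          (p : ℝ) * ∑ κ : Fin d × Bool, nobleXiIotaCls d p (fun N => 2 * N + 2) (𝐞 ι) (x + 𝐞 κ + 𝐞 ι)) := by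
        refine mul_le_mul_of_nonneg_left ?_ (mul_nonneg hμ0 hc2)
        rw [Finset.sum_add_distrib, Finset.mul_sum]
        exact add_le_add le_rfl (Finset.sum_le_sum fun κ _ => hE2 κ)
    _ ≤ i.mu * ((1 - i.mu ^ 2)⁻¹) ^ 2 *
        ((∑ κ : Fin d × Bool, S.piR ι κ (x + 𝐞 ι + 𝐞 κ)) +
          i.mub * ∑ κ : Fin d × Bool, nobleXiIotaCls d p (fun N => 2 * N + 2) (𝐞 ι) (x + 𝐞 κ + 𝐞 ι)) :=
        mul_le_mul (mul_le_mul hsc.mu_le hsc.c_sq_le hc2 hsc.imu_nonneg)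
          (add_le_add le_rfl (mul_le_mul_of_nonneg_right hsc.pbar_le (Finset.sum_nonneg fun κ _ => hY κ)))
          (add_nonneg (Finset.sum_nonneg fun κ _ => hR κ) (mul_nonneg hp0 (Finset.sum_nonneg fun κ _ => hY κ)))
          (mul_nonneg hsc.imu_nonneg (sq_nonneg _))
    _ = nobleMajM4 S i ι x := by rw [nobleMajM4]

/-- **Term 5**: `−M₅,ι(x) ≤ μ²c² Σ_κ (Π^{−ι,κ}(x+e_κ) + Π^{ι,κ}(x+e_ι) − μ Π^{−ι,κ}(x))` ((D.32) line 6).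
[cite: FitznerVanDerHofstad2016NoBLE, App. D (D.30), (D.32) line 6 (p. 1117)] -/
theorem neg_nobleMajM5_le (ι : Fin d × Bool) (x : Site d) : -nobleMajM5 d p i ι x ≤ nobleFRemT5 d p ι x := by
  have hμ0 := hsc.mu_nonneg
  have hc2 : 0 ≤ ((1 - nobleMu d p ^ 2)⁻¹) ^ 2 := sq_nonneg _
  have hp0 := hsc.pbar_nonneg
  have hE0 : ∀ (e κ : Fin d × Bool) (y : Site d), 0 ≤ noblePiCls d p (fun N => 2 * N) (𝐞 e) (𝐞 κ) y :=
    fun e κ y => noblePiCls_nonneg _ _ _ _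
  have hO0 : ∀ (e κ : Fin d × Bool) (y : Site d), 0 ≤ noblePiCls d p (fun N => 2 * N + 1) (𝐞 e) (𝐞 κ) y :=
    fun e κ y => noblePiCls_nonneg _ _ _ _
  have hYE0 : ∀ (e : Fin d × Bool) (y : Site d), 0 ≤ nobleXiIotaCls d p (fun N => 2 * N) (𝐞 e) y :=
    fun e y => nobleXiIotaCls_nonneg _ _ _
  have hYO0 : ∀ (e : Fin d × Bool) (y : Site d), 0 ≤ nobleXiIotaCls d p (fun N => 2 * N + 1) (𝐞 e) y :=
    fun e y => nobleXiIotaCls_nonneg _ _ _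
  have hEle : ∀ (e κ : Fin d × Bool) (y : Site d), noblePiCls d p (fun N => 2 * N) (𝐞 e) (𝐞 κ) y ≤
      (p : ℝ) * nobleXiIotaCls d p (fun N => 2 * N) (𝐞 e) y := fun e κ y => (noblePiCls_le hd hp e (h43.xiIotaEven e) κ y).2
  have hOle : ∀ (e κ : Fin d × Bool) (y : Site d), noblePiCls d p (fun N => 2 * N + 1) (𝐞 e) (𝐞 κ) y ≤
      (p : ℝ) * nobleXiIotaCls d p (fun N => 2 * N + 1) (𝐞 e) y := fun e κ y => (noblePiCls_le hd hp e (h43.xiIotaOdd e) κ y).2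
  refine neg_le_of_parts
    (A := nobleMu d p ^ 2 * ((1 - nobleMu d p ^ 2)⁻¹) ^ 2 * ∑ κ : Fin d × Bool,
      (noblePiCls d p (fun N => 2 * N) (𝐞 (srev ι)) (𝐞 κ) (x + 𝐞 κ) + noblePiCls d p (fun N => 2 * N) (𝐞 ι) (𝐞 κ) (x + 𝐞 ι) +
        nobleMu d p * noblePiCls d p (fun N => 2 * N + 1) (𝐞 (srev ι)) (𝐞 κ) x))
    (B := nobleMu d p ^ 2 * ((1 - nobleMu d p ^ 2)⁻¹) ^ 2 * ∑ κ : Fin d × Bool,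
      (noblePiCls d p (fun N => 2 * N + 1) (𝐞 (srev ι)) (𝐞 κ) (x + 𝐞 κ) + noblePiCls d p (fun N => 2 * N + 1) (𝐞 ι) (𝐞 κ) (x + 𝐞 ι) +
        nobleMu d p * noblePiCls d p (fun N => 2 * N) (𝐞 (srev ι)) (𝐞 κ) x))
    ?_ (mul_nonneg (mul_nonneg (sq_nonneg _) hc2) (Finset.sum_nonneg fun κ _ =>
      add_nonneg (add_nonneg (hE0 _ _ _) (hE0 _ _ _)) (mul_nonneg hμ0 (hO0 _ _ _)))) ?_
  · rw [nobleFRemT5, ← mul_sub, ← Finset.sum_sub_distrib]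
    congr 1
    exact Finset.sum_congr rfl fun κ _ => by simp only [noblePi_eq_even_sub_odd hd hp h43]; ring
  calc nobleMu d p ^ 2 * ((1 - nobleMu d p ^ 2)⁻¹) ^ 2 * ∑ κ : Fin d × Bool,
        (noblePiCls d p (fun N => 2 * N + 1) (𝐞 (srev ι)) (𝐞 κ) (x + 𝐞 κ) + noblePiCls d p (fun N => 2 * N + 1) (𝐞 ι) (𝐞 κ) (x + 𝐞 ι) +
          nobleMu d p * noblePiCls d p (fun N => 2 * N) (𝐞 (srev ι)) (𝐞 κ) x)
      ≤ nobleMu d p ^ 2 * ((1 - nobleMu d p ^ 2)⁻¹) ^ 2 * ((p : ℝ) * ∑ κ : Fin d × Bool,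
        (nobleXiIotaCls d p (fun N => 2 * N + 1) (𝐞 (srev ι)) (x + 𝐞 κ) + nobleXiIotaCls d p (fun N => 2 * N + 1) (𝐞 ι) (x + 𝐞 ι) +
          nobleMu d p * nobleXiIotaCls d p (fun N => 2 * N) (𝐞 (srev ι)) x)) := by
        refine mul_le_mul_of_nonneg_left ?_ (mul_nonneg (sq_nonneg _) hc2)
        rw [Finset.mul_sum]
        refine Finset.sum_le_sum fun κ _ => ?_
        calc noblePiCls d p (fun N => 2 * N + 1) (𝐞 (srev ι)) (𝐞 κ) (x + 𝐞 κ) + noblePiCls d p (fun N => 2 * N + 1) (𝐞 ι) (𝐞 κ) (x + 𝐞 ι) +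
              nobleMu d p * noblePiCls d p (fun N => 2 * N) (𝐞 (srev ι)) (𝐞 κ) x
            ≤ (p : ℝ) * nobleXiIotaCls d p (fun N => 2 * N + 1) (𝐞 (srev ι)) (x + 𝐞 κ) + (p : ℝ) * nobleXiIotaCls d p (fun N => 2 * N + 1) (𝐞 ι) (x + 𝐞 ι) +
              nobleMu d p * ((p : ℝ) * nobleXiIotaCls d p (fun N => 2 * N) (𝐞 (srev ι)) x) :=
              add_le_add (add_le_add (hOle _ _ _) (hOle _ _ _)) (mul_le_mul_of_nonneg_left (hEle _ _ _) hμ0)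
          _ = _ := by ring
    _ = nobleMu d p ^ 2 * ((1 - nobleMu d p ^ 2)⁻¹) ^ 2 * (p : ℝ) * ∑ κ : Fin d × Bool,
        (nobleXiIotaCls d p (fun N => 2 * N + 1) (𝐞 (srev ι)) (x + 𝐞 κ) + nobleXiIotaCls d p (fun N => 2 * N + 1) (𝐞 ι) (x + 𝐞 ι) +
          nobleMu d p * nobleXiIotaCls d p (fun N => 2 * N) (𝐞 (srev ι)) x) := by ring
    _ ≤ i.mu ^ 2 * ((1 - i.mu ^ 2)⁻¹) ^ 2 * i.mub * ∑ κ : Fin d × Bool,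
        (nobleXiIotaCls d p (fun N => 2 * N + 1) (𝐞 (srev ι)) (x + 𝐞 κ) + nobleXiIotaCls d p (fun N => 2 * N + 1) (𝐞 ι) (x + 𝐞 ι) +
          i.mu * nobleXiIotaCls d p (fun N => 2 * N) (𝐞 (srev ι)) x) :=
        mul_le_mul (mul_le_mul (mul_le_mul hsc.mu_sq_le hsc.c_sq_le hc2 (sq_nonneg _)) hsc.pbar_le hp0
          (mul_nonneg (sq_nonneg _) (sq_nonneg _)))
          (Finset.sum_le_sum fun κ _ => add_le_add le_rfl (mul_le_mul_of_nonneg_right hsc.mu_le (hYE0 _ _)))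
          (Finset.sum_nonneg fun κ _ => add_nonneg (add_nonneg (hYO0 _ _) (hYO0 _ _)) (mul_nonneg hμ0 (hYE0 _ _)))
          (mul_nonneg (mul_nonneg (sq_nonneg _) (sq_nonneg _)) hsc.imub_nonneg)
    _ = nobleMajM5 d p i ι x := by rw [nobleMajM5]; ring

/-- **Term 6**: `−M₆,ι(x) ≤ −μ(Ψ^ι ⋆ (A u)_ι)(x)` — parity domination of the cross terms ((D.31) last two lines,
(D.32) lines 7–9). [cite: FitznerVanDerHofstad2016NoBLE, App. D Step 5 ("can have a negative and a positive part"),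
(D.31)–(D.32) lines 7–9 (p. 1117)] -/
theorem neg_nobleMajM6_le (ι : Fin d × Bool) (x : Site d) : -nobleMajM6 d p i ι x ≤ nobleFRemT6 d p ι x := by
  have hμ0 := hsc.mu_nonneg
  have hc2 : 0 ≤ ((1 - nobleMu d p ^ 2)⁻¹) ^ 2 := sq_nonneg _
  have hp0 := hsc.pbar_nonneg
  have hE0 : ∀ (e κ : Fin d × Bool) (y : Site d), 0 ≤ noblePiCls d p (fun N => 2 * N) (𝐞 e) (𝐞 κ) y :=
    fun e κ y => noblePiCls_nonneg _ _ _ _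
  have hO0 : ∀ (e κ : Fin d × Bool) (y : Site d), 0 ≤ noblePiCls d p (fun N => 2 * N + 1) (𝐞 e) (𝐞 κ) y :=
    fun e κ y => noblePiCls_nonneg _ _ _ _
  have hYE0 : ∀ (e : Fin d × Bool) (y : Site d), 0 ≤ nobleXiIotaCls d p (fun N => 2 * N) (𝐞 e) y :=
    fun e y => nobleXiIotaCls_nonneg _ _ _
  have hYO0 : ∀ (e : Fin d × Bool) (y : Site d), 0 ≤ nobleXiIotaCls d p (fun N => 2 * N + 1) (𝐞 e) y :=
    fun e y => nobleXiIotaCls_nonneg _ _ _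
  have hEle : ∀ (e κ : Fin d × Bool) (y : Site d), noblePiCls d p (fun N => 2 * N) (𝐞 e) (𝐞 κ) y ≤
      (p : ℝ) * nobleXiIotaCls d p (fun N => 2 * N) (𝐞 e) y := fun e κ y => (noblePiCls_le hd hp e (h43.xiIotaEven e) κ y).2
  have hOle : ∀ (e κ : Fin d × Bool) (y : Site d), noblePiCls d p (fun N => 2 * N + 1) (𝐞 e) (𝐞 κ) y ≤
      (p : ℝ) * nobleXiIotaCls d p (fun N => 2 * N + 1) (𝐞 e) y := fun e κ y => (noblePiCls_le hd hp e (h43.xiIotaOdd e) κ y).2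
  -- parity splitting of `Ψ^ι` and of `(A u)_ι`
  have hΨ : noblePsi d p ι = fun y =>
      noblePsiCls d p (fun N => 2 * N) (𝐞 ι) y - noblePsiCls d p (fun N => 2 * N + 1) (𝐞 ι) y :=
    funext fun y => noblePsi_eq_even_sub_odd hd hp h43 ι y
  have hAU : nobleAU d p ι = fun z =>
      ((1 - nobleMu d p ^ 2)⁻¹) ^ 2 * ∑ κ : Fin d × Bool, (noblePiCls d p (fun N => 2 * N) (𝐞 ι) (𝐞 κ) (z + 𝐞 ι + 𝐞 κ) + nobleMu d p * noblePiCls d p (fun N => 2 * N + 1) (𝐞 (srev ι)) (𝐞 κ) (z + 𝐞 κ) +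
          nobleMu d p * noblePiCls d p (fun N => 2 * N + 1) (𝐞 ι) (𝐞 κ) (z + 𝐞 ι) + nobleMu d p ^ 2 * noblePiCls d p (fun N => 2 * N) (𝐞 (srev ι)) (𝐞 κ) z) -
      ((1 - nobleMu d p ^ 2)⁻¹) ^ 2 * ∑ κ : Fin d × Bool, (noblePiCls d p (fun N => 2 * N + 1) (𝐞 ι) (𝐞 κ) (z + 𝐞 ι + 𝐞 κ) + nobleMu d p * noblePiCls d p (fun N => 2 * N) (𝐞 (srev ι)) (𝐞 κ) (z + 𝐞 κ) +
          nobleMu d p * noblePiCls d p (fun N => 2 * N) (𝐞 ι) (𝐞 κ) (z + 𝐞 ι) + nobleMu d p ^ 2 * noblePiCls d p (fun N => 2 * N + 1) (𝐞 (srev ι)) (𝐞 κ) z) := by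
    funext z
    rw [nobleAU, ← mul_sub, ← Finset.sum_sub_distrib]
    congr 1
    exact Finset.sum_congr rfl fun κ _ => by simp only [noblePi_eq_even_sub_odd hd hp h43]; ring
  -- termwise dominations of the two parity parts of `(A u)_ι`
  have hBE : ∀ z, ((1 - nobleMu d p ^ 2)⁻¹) ^ 2 * ∑ κ : Fin d × Bool, (noblePiCls d p (fun N => 2 * N) (𝐞 ι) (𝐞 κ) (z + 𝐞 ι + 𝐞 κ) + nobleMu d p * noblePiCls d p (fun N => 2 * N + 1) (𝐞 (srev ι)) (𝐞 κ) (z + 𝐞 κ) +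
          nobleMu d p * noblePiCls d p (fun N => 2 * N + 1) (𝐞 ι) (𝐞 κ) (z + 𝐞 ι) + nobleMu d p ^ 2 * noblePiCls d p (fun N => 2 * N) (𝐞 (srev ι)) (𝐞 κ) z) ≤
      ((1 - nobleMu d p ^ 2)⁻¹) ^ 2 * (p : ℝ) * nobleMajBE d p i ι z := fun z => by
    rw [mul_assoc]
    refine mul_le_mul_of_nonneg_left ?_ hc2
    rw [nobleMajBE, Finset.mul_sum]
    refine Finset.sum_le_sum fun κ _ => ?_
    have h1 : noblePiCls d p (fun N => 2 * N) (𝐞 ι) (𝐞 κ) (z + 𝐞 ι + 𝐞 κ) ≤ (p : ℝ) * nobleXiIotaCls d p (fun N => 2 * N) (𝐞 ι) (z + 𝐞 κ + 𝐞 ι) := by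
      have h := hEle ι κ (z + 𝐞 ι + 𝐞 κ)
      rwa [add_right_comm z (𝐞 ι) (𝐞 κ)] at h ⊢
    have h2 := (mul_le_mul_of_nonneg_left (hOle (srev ι) κ (z + 𝐞 κ)) hμ0).trans
      (mul_le_mul_of_nonneg_right hsc.mu_le (mul_nonneg hp0 (hYO0 (srev ι) (z + 𝐞 κ))))
    have h3 := (mul_le_mul_of_nonneg_left (hOle ι κ (z + 𝐞 ι)) hμ0).trans
      (mul_le_mul_of_nonneg_right hsc.mu_le (mul_nonneg hp0 (hYO0 ι (z + 𝐞 ι))))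
    have h4 := (mul_le_mul_of_nonneg_left (hEle (srev ι) κ z) (sq_nonneg (nobleMu d p))).trans
      (mul_le_mul_of_nonneg_right hsc.mu_sq_le (mul_nonneg hp0 (hYE0 (srev ι) z)))
    calc _ ≤ (p : ℝ) * nobleXiIotaCls d p (fun N => 2 * N) (𝐞 ι) (z + 𝐞 κ + 𝐞 ι) + i.mu * ((p : ℝ) * nobleXiIotaCls d p (fun N => 2 * N + 1) (𝐞 (srev ι)) (z + 𝐞 κ)) +
          i.mu * ((p : ℝ) * nobleXiIotaCls d p (fun N => 2 * N + 1) (𝐞 ι) (z + 𝐞 ι)) + i.mu ^ 2 * ((p : ℝ) * nobleXiIotaCls d p (fun N => 2 * N) (𝐞 (srev ι)) z) :=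
          add_le_add (add_le_add (add_le_add h1 h2) h3) h4
      _ = _ := by ring
  have hBO : ∀ z, ((1 - nobleMu d p ^ 2)⁻¹) ^ 2 * ∑ κ : Fin d × Bool, (noblePiCls d p (fun N => 2 * N + 1) (𝐞 ι) (𝐞 κ) (z + 𝐞 ι + 𝐞 κ) + nobleMu d p * noblePiCls d p (fun N => 2 * N) (𝐞 (srev ι)) (𝐞 κ) (z + 𝐞 κ) +
          nobleMu d p * noblePiCls d p (fun N => 2 * N) (𝐞 ι) (𝐞 κ) (z + 𝐞 ι) + nobleMu d p ^ 2 * noblePiCls d p (fun N => 2 * N + 1) (𝐞 (srev ι)) (𝐞 κ) z) ≤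
      ((1 - nobleMu d p ^ 2)⁻¹) ^ 2 * (p : ℝ) * nobleMajBO d p i ι z := fun z => by
    rw [mul_assoc]
    refine mul_le_mul_of_nonneg_left ?_ hc2
    rw [nobleMajBO, Finset.mul_sum]
    refine Finset.sum_le_sum fun κ _ => ?_
    have h1 : noblePiCls d p (fun N => 2 * N + 1) (𝐞 ι) (𝐞 κ) (z + 𝐞 ι + 𝐞 κ) ≤ (p : ℝ) * nobleXiIotaCls d p (fun N => 2 * N + 1) (𝐞 ι) (z + 𝐞 κ + 𝐞 ι) := by
      have h := hOle ι κ (z + 𝐞 ι + 𝐞 κ)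
      rwa [add_right_comm z (𝐞 ι) (𝐞 κ)] at h ⊢
    have h2 := (mul_le_mul_of_nonneg_left (hEle (srev ι) κ (z + 𝐞 κ)) hμ0).trans
      (mul_le_mul_of_nonneg_right hsc.mu_le (mul_nonneg hp0 (hYE0 (srev ι) (z + 𝐞 κ))))
    have h3 := (mul_le_mul_of_nonneg_left (hEle ι κ (z + 𝐞 ι)) hμ0).trans
      (mul_le_mul_of_nonneg_right hsc.mu_le (mul_nonneg hp0 (hYE0 ι (z + 𝐞 ι))))
    have h4 := (mul_le_mul_of_nonneg_left (hOle (srev ι) κ z) (sq_nonneg (nobleMu d p))).trans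
      (mul_le_mul_of_nonneg_right hsc.mu_sq_le (mul_nonneg hp0 (hYO0 (srev ι) z)))
    calc _ ≤ (p : ℝ) * nobleXiIotaCls d p (fun N => 2 * N + 1) (𝐞 ι) (z + 𝐞 κ + 𝐞 ι) + i.mu * ((p : ℝ) * nobleXiIotaCls d p (fun N => 2 * N) (𝐞 (srev ι)) (z + 𝐞 κ)) +
          i.mu * ((p : ℝ) * nobleXiIotaCls d p (fun N => 2 * N) (𝐞 ι) (z + 𝐞 ι)) + i.mu ^ 2 * ((p : ℝ) * nobleXiIotaCls d p (fun N => 2 * N + 1) (𝐞 (srev ι)) z) :=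
          add_le_add (add_le_add (add_le_add h1 h2) h3) h4
      _ = _ := by ring
  have hbE0 : ∀ z, 0 ≤ ((1 - nobleMu d p ^ 2)⁻¹) ^ 2 * ∑ κ : Fin d × Bool, (noblePiCls d p (fun N => 2 * N) (𝐞 ι) (𝐞 κ) (z + 𝐞 ι + 𝐞 κ) + nobleMu d p * noblePiCls d p (fun N => 2 * N + 1) (𝐞 (srev ι)) (𝐞 κ) (z + 𝐞 κ) +
          nobleMu d p * noblePiCls d p (fun N => 2 * N + 1) (𝐞 ι) (𝐞 κ) (z + 𝐞 ι) + nobleMu d p ^ 2 * noblePiCls d p (fun N => 2 * N) (𝐞 (srev ι)) (𝐞 κ) z) := fun z =>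
    mul_nonneg hc2 (Finset.sum_nonneg fun κ _ => add_nonneg (add_nonneg (add_nonneg (hE0 _ _ _)
      (mul_nonneg hμ0 (hO0 _ _ _))) (mul_nonneg hμ0 (hO0 _ _ _))) (mul_nonneg (sq_nonneg _) (hE0 _ _ _)))
  have hbO0 : ∀ z, 0 ≤ ((1 - nobleMu d p ^ 2)⁻¹) ^ 2 * ∑ κ : Fin d × Bool, (noblePiCls d p (fun N => 2 * N + 1) (𝐞 ι) (𝐞 κ) (z + 𝐞 ι + 𝐞 κ) + nobleMu d p * noblePiCls d p (fun N => 2 * N) (𝐞 (srev ι)) (𝐞 κ) (z + 𝐞 κ) +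
          nobleMu d p * noblePiCls d p (fun N => 2 * N) (𝐞 ι) (𝐞 κ) (z + 𝐞 ι) + nobleMu d p ^ 2 * noblePiCls d p (fun N => 2 * N + 1) (𝐞 (srev ι)) (𝐞 κ) z) := fun z =>
    mul_nonneg hc2 (Finset.sum_nonneg fun κ _ => add_nonneg (add_nonneg (add_nonneg (hO0 _ _ _)
      (mul_nonneg hμ0 (hE0 _ _ _))) (mul_nonneg hμ0 (hE0 _ _ _))) (mul_nonneg (sq_nonneg _) (hO0 _ _ _)))
  have hMBE := momentBound_nobleMajBE hsc h43 ι
  have hMBO := momentBound_nobleMajBO hsc h43 ι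
  have key : lconv (fun y => noblePsiCls d p (fun N => 2 * N) (𝐞 ι) y - noblePsiCls d p (fun N => 2 * N + 1) (𝐞 ι) y)
      (fun z => ((1 - nobleMu d p ^ 2)⁻¹) ^ 2 * ∑ κ : Fin d × Bool, (noblePiCls d p (fun N => 2 * N) (𝐞 ι) (𝐞 κ) (z + 𝐞 ι + 𝐞 κ) + nobleMu d p * noblePiCls d p (fun N => 2 * N + 1) (𝐞 (srev ι)) (𝐞 κ) (z + 𝐞 κ) +
          nobleMu d p * noblePiCls d p (fun N => 2 * N + 1) (𝐞 ι) (𝐞 κ) (z + 𝐞 ι) + nobleMu d p ^ 2 * noblePiCls d p (fun N => 2 * N) (𝐞 (srev ι)) (𝐞 κ) z) -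
      ((1 - nobleMu d p ^ 2)⁻¹) ^ 2 * ∑ κ : Fin d × Bool, (noblePiCls d p (fun N => 2 * N + 1) (𝐞 ι) (𝐞 κ) (z + 𝐞 ι + 𝐞 κ) + nobleMu d p * noblePiCls d p (fun N => 2 * N) (𝐞 (srev ι)) (𝐞 κ) (z + 𝐞 κ) +
          nobleMu d p * noblePiCls d p (fun N => 2 * N) (𝐞 ι) (𝐞 κ) (z + 𝐞 ι) + nobleMu d p ^ 2 * noblePiCls d p (fun N => 2 * N + 1) (𝐞 (srev ι)) (𝐞 κ) z)) x ≤
      lconv (fun y => (p : ℝ) / nobleMu d p * nobleXiCls d p (fun N => 2 * N) y)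
          (fun z => ((1 - nobleMu d p ^ 2)⁻¹) ^ 2 * (p : ℝ) * nobleMajBE d p i ι z) x +
        lconv (fun y => (p : ℝ) / nobleMu d p * nobleXiCls d p (fun N => 2 * N + 1) y)
          (fun z => ((1 - nobleMu d p ^ 2)⁻¹) ^ 2 * (p : ℝ) * nobleMajBO d p i ι z) x :=
    lconv_sub_sub_le (fun y => noblePsiCls_nonneg _ _ y) (fun y => noblePsiCls_nonneg _ _ y) hbE0 hbO0
      (fun y => (noblePsiCls_le hd hp h43.xiEven ι y).2) (fun y => (noblePsiCls_le hd hp h43.xiOdd ι y).2) hBE hBO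
      ((momentBound_xiCls_even h43).summable.mul_left _) ((momentBound_xiCls_odd h43).summable.mul_left _)
      (hMBE.summable.mul_left _) (hMBO.summable.mul_left _) x
  rw [lconv_const_mul_left, lconv_const_mul_right, lconv_const_mul_left, lconv_const_mul_right] at key
  have hL1 := lconv_nonneg (nobleXiCls_nonneg (p := p) fun N => 2 * N) hMBE.nonneg x
  have hL2 := lconv_nonneg (nobleXiCls_nonneg (p := p) fun N => 2 * N + 1) hMBO.nonneg x
  rw [nobleFRemT6, hΨ, hAU, neg_le_neg_iff]
  calc _ ≤ nobleMu d p * ((p : ℝ) / nobleMu d p * (((1 - nobleMu d p ^ 2)⁻¹) ^ 2 * (p : ℝ) *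
          lconv (nobleXiCls d p fun N => 2 * N) (nobleMajBE d p i ι) x) +
        (p : ℝ) / nobleMu d p * (((1 - nobleMu d p ^ 2)⁻¹) ^ 2 * (p : ℝ) *
          lconv (nobleXiCls d p fun N => 2 * N + 1) (nobleMajBO d p i ι) x)) := mul_le_mul_of_nonneg_left key hμ0
    _ = nobleMu d p * ((p : ℝ) / nobleMu d p) * (p : ℝ) * ((1 - nobleMu d p ^ 2)⁻¹) ^ 2 *
        (lconv (nobleXiCls d p fun N => 2 * N) (nobleMajBE d p i ι) x +
          lconv (nobleXiCls d p fun N => 2 * N + 1) (nobleMajBO d p i ι) x) := by ring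
    _ = (p : ℝ) * (p : ℝ) * ((1 - nobleMu d p ^ 2)⁻¹) ^ 2 *
        (lconv (nobleXiCls d p fun N => 2 * N) (nobleMajBE d p i ι) x +
          lconv (nobleXiCls d p fun N => 2 * N + 1) (nobleMajBO d p i ι) x) := by rw [hsc.mu_mul_qp]
    _ ≤ i.mub * i.mub * ((1 - i.mu ^ 2)⁻¹) ^ 2 *
        (lconv (nobleXiCls d p fun N => 2 * N) (nobleMajBE d p i ι) x +
          lconv (nobleXiCls d p fun N => 2 * N + 1) (nobleMajBO d p i ι) x) :=
        mul_le_mul_of_nonneg_right (mul_le_mul (mul_le_mul hsc.pbar_le hsc.pbar_le hp0 hsc.imub_nonneg) hsc.c_sq_le hc2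
          (mul_nonneg hsc.imub_nonneg hsc.imub_nonneg)) (add_nonneg hL1 hL2)
    _ = nobleMajM6 d p i ι x := by rw [nobleMajM6]; ring

/-- **`−m(x) ≤ Σ_ι R^F_ι(x)`**: the six term bounds summed. [cite: FitznerVanDerHofstad2016NoBLE, App. D Step 5 (D.30)–(D.32) (p. 1117)] -/
theorem neg_nobleMaj_le_sum_dirRem [NeZero d] (h : NobleL1At d p P X) (ht1 : nobleMajT d i < 1) (x : Site d) :
    -nobleMaj S i x ≤ ∑ ι, nobleFDirRem S ι x := by
  have h1 := neg_nobleMajM1_le hd hp hsc h43 h ht1 x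
  have h2 := fun ι => neg_nobleMajM2_le hd hp hsc h43 ι x
  have h3 := fun ι => neg_nobleMajM3_le hsc (S := S) ι x
  have h4 := fun ι => neg_nobleMajM4_le hd hp hsc h43 ι x
  have h5 := fun ι => neg_nobleMajM5_le hd hp hsc h43 ι x
  have h6 := fun ι => neg_nobleMajM6_le hd hp hsc h43 ι x
  have hs : ∑ ι, nobleFDirRem S ι x = (∑ ι, nobleFRemT1 d p ι x) +
      ∑ ι, (nobleFRemT2 d p ι x + nobleFRemT3 S ι x + nobleFRemT4 S ι x + nobleFRemT5 d p ι x + nobleFRemT6 d p ι x) := by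
    rw [← Finset.sum_add_distrib]
    exact Finset.sum_congr rfl fun ι _ => by unfold nobleFDirRem; ring
  rw [hs, nobleMaj, neg_add, ← Finset.sum_neg_distrib]
  refine add_le_add h1 (Finset.sum_le_sum fun ι _ => ?_)
  simp only [neg_add]
  exact add_le_add (add_le_add (add_le_add (add_le_add (h2 ι) (h3 ι)) (h4 ι)) (h5 ι)) (h6 ι)

/-- **`−m ≤ R_F` pointwise** ([NoBLE17] App. D Step 4 for `F`: "create a bound of the form (D.29)").
[cite: FitznerVanDerHofstad2016NoBLE, App. D Step 4 (D.29) (p. 1116), Step 5 (D.30)–(D.32) (p. 1117)] -/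
theorem neg_nobleMaj_le_nobleFRem [NeZero d] (h : NobleL1At d p P X) (hT : IsTRS (nobleFAlpha S))
    (ht1 : nobleMajT d i < 1) (x : Site d) : -nobleMaj S i x ≤ nobleFRem S x := by
  rw [nobleFRem_eq_sum_dirRem hd hp h h43 hT x]
  exact neg_nobleMaj_le_sum_dirRem hd hp hsc h43 h ht1 x

end MajorantPointwise

/-! ## Part F3 (module 3c-B). Total rotational symmetry of the majorant, its total moment bound -/

section MajorantTRS

local notation "𝐞" => Literature.Probability.Percolation.stepVec

variable {p : unitInterval} {P X : ℝ} {i : BetaMap.Inputs} {S : NobleSplit d p}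

/-- Transport of `IsTRS` along a pointwise equality. [folklore] -/
theorem IsTRS.of_eq {f g : Site d → ℝ} (hf : IsTRS f) (h : ∀ x, f x = g x) : IsTRS g := by
  have e : f = g := funext h
  subst e
  exact hf

/-- `IsTRS` of the iterates `t^{(n)} = B^{⋆ n} ⋆ t₀` of TRS data. [cite: FitznerVanDerHofstad2016NoBLE, App. D Step 4 (p. 1116) ("all terms are totally rotationally symmetric")] -/
theorem isTRS_titer {B t0 : Site d → ℝ} (hB : IsTRS B) (h0 : IsTRS t0) : ∀ n, IsTRS (titer B t0 n)
  | 0 => by rw [titer_zero]; exact h0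
  | n + 1 => by rw [titer_succ]; exact hB.lconv (isTRS_titer hB h0 n)

/-- `t₀` is TRS. [cite: FitznerVanDerHofstad2016NoBLE, App. D (D.6) (p. 1111)] -/
theorem isTRS_nobleMajT0 : IsTRS (nobleMajT0 d i) :=
  (((isTRS_nobleDelta.sum_dir_comp_add_stepVec).add (isTRS_nobleDelta.const_mul (2 * d * i.mu))).const_mul
    ((1 - i.mu ^ 2)⁻¹)).of_eq fun x => by simp only [nobleMajT0]

/-- `τ₂` is TRS. [cite: FitznerVanDerHofstad2016NoBLE, App. D (D.8), (D.29) (pp. 1112, 1116)] -/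
theorem isTRS_nobleMajTau2 : IsTRS (nobleMajTau2 d p i) :=
  (isTRS_tsum fun n => isTRS_titer isTRS_nobleMajB isTRS_nobleMajT0 (n + 2)).of_eq fun _ => rfl

/-- `M₁` is TRS. [cite: FitznerVanDerHofstad2016NoBLE, App. D Step 5 (p. 1117)] -/
theorem isTRS_nobleMajM1 : IsTRS (nobleMajM1 d p i) :=
  (((isTRS_nobleMajTau2 (p := p) (i := i)).const_mul i.mu).add
    (((isTRS_nobleXiCls (p := p) fun N => N).lconv (isTRS_nobleMajTau2 (p := p) (i := i))).const_mul
      (i.mu * i.mubOverMu))).of_eq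
    fun x => by simp only [nobleMajM1]

/-- `Σ_ι M₂,ι` is TRS. [cite: FitznerVanDerHofstad2016NoBLE, App. D Step 5 (p. 1117); FitznerVanDerHofstad2017, §3.5] -/
theorem isTRS_sum_nobleMajM2 : IsTRS (fun x => ∑ ι, nobleMajM2 d p i ι x) :=
  (isTRS_sum_of_relabel
    (fun e x => i.mu * i.mubOverMu * (1 - i.mu ^ 2)⁻¹ *
      (nobleXiCls d p (fun N => 2 * N + 3) (x + e) + i.mu * nobleXiCls d p (fun N => 2 * N + 2) x))
    fun π ε e x => by simp only [← zdSignedPermIso_add, nobleXiCls_relabel]).of_eq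
    fun x => by simp only [nobleMajM2]

/-- `Σ_ι M₃,ι` is TRS, given the TRS of the shifted `Ψ^{(1)}_{α,I}`-sum (automatic for percolation) and (4.27).
[cite: FitznerVanDerHofstad2016NoBLE, Assumption 4.1 (4.27) (p. 1085); FitznerVanDerHofstad2017, §3.5] -/
theorem isTRS_sum_nobleMajM3 (h41 : NobleAssumption41At d p S)
    (hI : ∀ N ≤ 1, IsTRS (fun x => ∑ ι, S.psiAI N ι (x + 𝐞 ι))) : IsTRS (fun x => ∑ ι, nobleMajM3 S i ι x) := by
  have hA : IsTRS (fun x => ∑ ι, noblePsiN d p (𝐞 ι) 1 (x + 𝐞 ι)) :=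
    isTRS_sum_of_relabel (fun e x => noblePsiN d p e 1 (x + e)) fun π ε e x => by
      simp only [← zdSignedPermIso_add]
      exact noblePsiN_relabel _ (zdSignedPermIso_sub π ε) p e 1 (x + e)
  refine ((((hA.sub (hI 1 le_rfl)).add ((h41.psiRIISum_trs 0 zero_le_one).const_mul i.mu)).const_mul
    (i.mu * (1 - i.mu ^ 2)⁻¹))).of_eq fun x => ?_
  simp only [nobleMajM3, NobleSplit.psiRI, Finset.mul_sum, Finset.sum_add_distrib, Finset.sum_sub_distrib, mul_add,
    mul_sub]

/-- `Σ_ι M₄,ι` is TRS, given the TRS of the shifted `Π_α`-sum (automatic for percolation).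
[cite: FitznerVanDerHofstad2016NoBLE, Assumption 4.1 (4.27) (p. 1085); FitznerVanDerHofstad2017, §3.5] -/
theorem isTRS_sum_nobleMajM4 (hPi : IsTRS (fun x => ∑ ι, ∑ κ, S.piA ι κ (x + 𝐞 ι + 𝐞 κ))) :
    IsTRS (fun x => ∑ ι, nobleMajM4 S i ι x) := by
  have hA : IsTRS (fun x => ∑ ι, ∑ κ, noblePiN d p (𝐞 ι) (𝐞 κ) 0 (x + 𝐞 ι + 𝐞 κ)) :=
    isTRS_sum_sum_of_relabel (fun e e' x => noblePiN d p e e' 0 (x + e + e')) fun π ε e e' x => by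
      simp only [← zdSignedPermIso_add]
      exact noblePiN_relabel _ (zdSignedPermIso_sub π ε) p e e' 0 (x + e + e')
  have hY : IsTRS (fun x => ∑ ι, ∑ κ, nobleXiIotaCls d p (fun N => 2 * N + 2) (𝐞 ι) (x + 𝐞 κ + 𝐞 ι)) :=
    isTRS_sum_sum_of_relabel (fun e e' x => nobleXiIotaCls d p (fun N => 2 * N + 2) e (x + e' + e))
      fun π ε e e' x => by simp only [← zdSignedPermIso_add, nobleXiIotaCls_relabel]
  refine (((hA.sub hPi).add (hY.const_mul i.mub)).const_mul (i.mu * ((1 - i.mu ^ 2)⁻¹) ^ 2)).of_eq fun x => ?_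
  simp only [nobleMajM4, NobleSplit.piR, Finset.mul_sum, Finset.sum_add_distrib, Finset.sum_sub_distrib, mul_add,
    mul_sub]

/-- `Σ_ι M₅,ι` is TRS. [cite: FitznerVanDerHofstad2017, §3.5 (Symmetry of the model)] -/
theorem isTRS_sum_nobleMajM5 : IsTRS (fun x => ∑ ι, nobleMajM5 d p i ι x) := by
  refine (isTRS_sum_sum_of_relabel
    (fun e e' x => i.mu ^ 2 * i.mub * ((1 - i.mu ^ 2)⁻¹) ^ 2 *
      (nobleXiIotaCls d p (fun N => 2 * N + 1) (-e) (x + e') + nobleXiIotaCls d p (fun N => 2 * N + 1) e (x + e) +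
        i.mu * nobleXiIotaCls d p (fun N => 2 * N) (-e) x))
    fun π ε e e' x => by simp only [← zdSignedPermIso_add, ← zdSignedPermIso_neg, nobleXiIotaCls_relabel]).of_eq
    fun x => ?_
  simp only [nobleMajM5, stepVec_srev, Finset.mul_sum]

/-- `B^E` as a function of the direction VECTOR `e` (`B^E_ι = B^E[e_ι]`), for transport under the lattice
symmetries. [cite: FitznerVanDerHofstad2016NoBLE, App. D Step 4 (D.28)–(D.29) (p. 1116)] -/
def nobleMajBEv (d : ℕ) (p : unitInterval) (i : BetaMap.Inputs) (e z : Site d) : ℝ :=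
  ∑ κ : Fin d × Bool, (nobleXiIotaCls d p (fun N => 2 * N) e (z + 𝐞 κ + e) +
    i.mu * nobleXiIotaCls d p (fun N => 2 * N + 1) (-e) (z + 𝐞 κ) +
      i.mu * nobleXiIotaCls d p (fun N => 2 * N + 1) e (z + e) +
        i.mu ^ 2 * nobleXiIotaCls d p (fun N => 2 * N) (-e) z)

/-- `B^O` as a function of the direction vector. [cite: FitznerVanDerHofstad2016NoBLE, App. D Step 4 (D.28)–(D.29) (p. 1116)] -/
def nobleMajBOv (d : ℕ) (p : unitInterval) (i : BetaMap.Inputs) (e z : Site d) : ℝ :=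
  ∑ κ : Fin d × Bool, (nobleXiIotaCls d p (fun N => 2 * N + 1) e (z + 𝐞 κ + e) +
    i.mu * nobleXiIotaCls d p (fun N => 2 * N) (-e) (z + 𝐞 κ) +
      i.mu * nobleXiIotaCls d p (fun N => 2 * N) e (z + e) +
        i.mu ^ 2 * nobleXiIotaCls d p (fun N => 2 * N + 1) (-e) z)

/-- [folklore] -/
theorem nobleMajBE_eq (ι : Fin d × Bool) : nobleMajBE d p i ι = nobleMajBEv d p i (𝐞 ι) := by
  funext z
  simp only [nobleMajBE, nobleMajBEv, stepVec_srev]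

/-- [folklore] -/
theorem nobleMajBO_eq (ι : Fin d × Bool) : nobleMajBO d p i ι = nobleMajBOv d p i (𝐞 ι) := by
  funext z
  simp only [nobleMajBO, nobleMajBOv, stepVec_srev]

/-- `B^E[σe](σz) = B^E[e](z)` for every signed coordinate permutation `σ`. [cite: FitznerVanDerHofstad2017, §3.5 (Symmetry of the model)] -/
theorem nobleMajBEv_relabel (π : Equiv.Perm (Fin d)) (ε : Fin d → ℤˣ) (e z : Site d) :
    nobleMajBEv d p i (zdSignedPermIso π ε e) (zdSignedPermIso π ε z) = nobleMajBEv d p i e z := by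
  unfold nobleMajBEv
  refine (sum_dir_relabel (fun e' => nobleXiIotaCls d p (fun N => 2 * N) (zdSignedPermIso π ε e)
      (zdSignedPermIso π ε z + e' + zdSignedPermIso π ε e) +
    i.mu * nobleXiIotaCls d p (fun N => 2 * N + 1) (-zdSignedPermIso π ε e) (zdSignedPermIso π ε z + e') +
      i.mu * nobleXiIotaCls d p (fun N => 2 * N + 1) (zdSignedPermIso π ε e)
        (zdSignedPermIso π ε z + zdSignedPermIso π ε e) +
        i.mu ^ 2 * nobleXiIotaCls d p (fun N => 2 * N) (-zdSignedPermIso π ε e) (zdSignedPermIso π ε z)) π ε).symm.trans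
    ?_
  simp only [← zdSignedPermIso_add, ← zdSignedPermIso_neg, nobleXiIotaCls_relabel]

/-- `B^O[σe](σz) = B^O[e](z)`. [cite: FitznerVanDerHofstad2017, §3.5 (Symmetry of the model)] -/
theorem nobleMajBOv_relabel (π : Equiv.Perm (Fin d)) (ε : Fin d → ℤˣ) (e z : Site d) :
    nobleMajBOv d p i (zdSignedPermIso π ε e) (zdSignedPermIso π ε z) = nobleMajBOv d p i e z := by
  unfold nobleMajBOv
  refine (sum_dir_relabel (fun e' => nobleXiIotaCls d p (fun N => 2 * N + 1) (zdSignedPermIso π ε e)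
      (zdSignedPermIso π ε z + e' + zdSignedPermIso π ε e) +
    i.mu * nobleXiIotaCls d p (fun N => 2 * N) (-zdSignedPermIso π ε e) (zdSignedPermIso π ε z + e') +
      i.mu * nobleXiIotaCls d p (fun N => 2 * N) (zdSignedPermIso π ε e)
        (zdSignedPermIso π ε z + zdSignedPermIso π ε e) +
        i.mu ^ 2 * nobleXiIotaCls d p (fun N => 2 * N + 1) (-zdSignedPermIso π ε e) (zdSignedPermIso π ε z)) π ε).symm.trans
    ?_
  simp only [← zdSignedPermIso_add, ← zdSignedPermIso_neg, nobleXiIotaCls_relabel]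

/-- `Σ_ι M₆,ι` is TRS. [cite: FitznerVanDerHofstad2017, §3.5 (Symmetry of the model)] -/
theorem isTRS_sum_nobleMajM6 : IsTRS (fun x => ∑ ι, nobleMajM6 d p i ι x) := by
  refine (isTRS_sum_of_relabel
    (fun e x => i.mub ^ 2 * ((1 - i.mu ^ 2)⁻¹) ^ 2 *
      (lconv (nobleXiCls d p fun N => 2 * N) (nobleMajBEv d p i e) x +
        lconv (nobleXiCls d p fun N => 2 * N + 1) (nobleMajBOv d p i e) x))
    fun π ε e x => ?_).of_eq fun x => ?_
  · simp only [lconv_zdSignedPermIso π ε (fun y => nobleXiCls_relabel π ε (fun N => 2 * N) y)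
        (fun y => nobleMajBEv_relabel (p := p) (i := i) π ε e y) x,
      lconv_zdSignedPermIso π ε (fun y => nobleXiCls_relabel π ε (fun N => 2 * N + 1) y)
        (fun y => nobleMajBOv_relabel (p := p) (i := i) π ε e y) x]
  · simp only [nobleMajM6, nobleMajBE_eq, nobleMajBO_eq]

/-- **The majorant `m` is totally rotationally symmetric** (given Assumption 4.1 and the TRS of the shifted
`α`-sums, both theorems for percolation). [cite: FitznerVanDerHofstad2016NoBLE, App. D Step 5 (p. 1117) ("m is
totally rotationally symmetric"); Assumption 4.1 (p. 1085); FitznerVanDerHofstad2017, §3.5] -/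
theorem isTRS_nobleMaj (h41 : NobleAssumption41At d p S)
    (hI : ∀ N ≤ 1, IsTRS (fun x => ∑ ι, S.psiAI N ι (x + 𝐞 ι)))
    (hPi : IsTRS (fun x => ∑ ι, ∑ κ, S.piA ι κ (x + 𝐞 ι + 𝐞 κ))) : IsTRS (nobleMaj S i) :=
  ((isTRS_nobleMajM1 (p := p) (i := i)).add (((((isTRS_sum_nobleMajM2 (p := p) (i := i)).add
    (isTRS_sum_nobleMajM3 (i := i) h41 hI)).add (isTRS_sum_nobleMajM4 (i := i) hPi)).add
    (isTRS_sum_nobleMajM5 (p := p) (i := i))).add (isTRS_sum_nobleMajM6 (p := p) (i := i)))).of_eq fun x => by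
    simp only [nobleMaj, Finset.sum_add_distrib]

variable (hsc : NobleScalarFacts d p i) (h43 : NobleAssumption43At d p S i)
include hsc h43

/-- **The total moment bound of `m`** — mass and displacement constants assembled from the six terms
((D.29)–(D.32)). [cite: FitznerVanDerHofstad2016NoBLE, App. D Steps 4–5 (D.29)–(D.32) (pp. 1116–1117)] -/
theorem momentBound_nobleMaj (ht1 : nobleMajT d i < 1) : ∃ L, MomentBound (nobleMaj S i) L
    (i.mu * nobleMajW2 d i + i.mu * i.mubOverMu * (i.xiDeltaAbs * nobleMajA2 d i + i.xiAbs * nobleMajW2 d i) +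
      (i.mu * i.mubOverMu * (1 - i.mu ^ 2)⁻¹ *
          (2 * d * (i.xiOddTailDelta + i.xiOddTail) + i.mu * (2 * d * i.xiEvenTailDelta)) +
        2 * d * (i.mu * (1 - i.mu ^ 2)⁻¹ * (i.psiRI1Delta + i.mu * i.psiRII0Delta)) +
        i.mu * ((1 - i.mu ^ 2)⁻¹) ^ 2 *
          (i.piR0DeltaEiEk + i.mub * (2 * d * (2 * d * (i.xiIotaEvenTailDeltaEi + i.xiIotaEvenTail)))) +
        2 * d * (i.mu ^ 2 * i.mub * ((1 - i.mu ^ 2)⁻¹) ^ 2 *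
          (2 * d * (i.xiIotaOddDeltaZero + i.xiIotaOdd) + 2 * d * i.xiIotaOddDeltaEi +
            2 * d * (i.mu * i.xiIotaEvenDeltaZero))) +
        2 * d * (i.mub ^ 2 * ((1 - i.mu ^ 2)⁻¹) ^ 2 *
          ((i.xiEvenDelta * (2 * d * i.xiIotaEven + 2 * d * (i.mu * i.xiIotaOdd) + 2 * d * (i.mu * i.xiIotaOdd) +
                2 * d * (i.mu ^ 2 * i.xiIotaEven)) +
              i.xiEven * (2 * d * (i.xiIotaEvenDeltaEi + i.xiIotaEven) +
                2 * d * (i.mu * i.xiIotaOddDeltaZero + i.mu * i.xiIotaOdd) + 2 * d * (i.mu * i.xiIotaOddDeltaEi) +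
                  2 * d * (i.mu ^ 2 * i.xiIotaEvenDeltaZero))) +
            (i.xiOddDelta * (2 * d * i.xiIotaOdd + 2 * d * (i.mu * i.xiIotaEven) + 2 * d * (i.mu * i.xiIotaEven) +
                2 * d * (i.mu ^ 2 * i.xiIotaOdd)) +
              i.xiOdd * (2 * d * (i.xiIotaOddDeltaEi + i.xiIotaOdd) +
                2 * d * (i.mu * i.xiIotaEvenDeltaZero + i.mu * i.xiIotaEven) + 2 * d * (i.mu * i.xiIotaEvenDeltaEi) +
                  2 * d * (i.mu ^ 2 * i.xiIotaOddDeltaZero))))))) := by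
  obtain ⟨L2, h2⟩ := momentBound_sum_nobleMajM2 hsc h43
  obtain ⟨L4, h4⟩ := momentBound_sum_nobleMajM4 hsc h43
  have h := (momentBound_nobleMajM1 hsc h43 ht1).add
    ((((h2.add (MomentBound.sum_dir fun ι => momentBound_nobleMajM3 hsc h43 ι)).add h4).add
      (MomentBound.sum_dir fun ι => momentBound_nobleMajM5 hsc h43 ι)).add
      (MomentBound.sum_dir fun ι => momentBound_nobleMajM6 hsc h43 ι))
  exact ⟨_, h.congr fun x => by simp only [nobleMaj, Finset.sum_add_distrib]⟩

/-- **`Σ_x ‖x‖₂² m(x) ≤ β^{corr}_{ΔR,F}(i)`** and the data of `m` needed by Lemma 2.12.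
[cite: FitznerVanDerHofstad2016NoBLE, App. D Step 5 (D.32) (p. 1117)] -/
theorem nobleMaj_data (ht1 : nobleMajT d i < 1) :
    Summable (nobleMaj S i) ∧ (∀ x, 0 ≤ nobleMaj S i x) ∧ (Summable fun x => euclidNorm x ^ 2 * nobleMaj S i x) ∧
      ∑' x, euclidNorm x ^ 2 * nobleMaj S i x ≤ (BetaMap.nobleBetaOfInputsCorr d i).βΔ := by
  obtain ⟨L, hM⟩ := momentBound_nobleMaj hsc h43 ht1
  exact ⟨hM.summable, hM.nonneg, hM.summableW, hM.tsumW_le.trans (le_of_eq nobleMajW_eq)⟩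

end MajorantTRS

/-! ## Part G (module 3c-B). Assembly: Prop. 4.5(ii) with (D.32) discharged by the constructed majorant -/

section Assembly5

local notation "𝐞" => Literature.Probability.Percolation.stepVec

variable {p : unitInterval} {i : BetaMap.Inputs} {S : NobleSplit d p}

variable (hd : 2 ≤ d) (hp : p < criticalProbI d)
include hd hp

/-- **[NoBLE17, Prop. 4.5(ii) / App. D, Steps 1–5 — theorem form].** Under the NoBLE equation at `p`,
Assumption 4.1 for the split `S`, Assumption 4.3 at `p` with constants `i` (well-formed), the TRS of the three
shifted `α`-sums (automatic for percolation) and the decidable sign side conditions (N1') `0 ≤ c̲_Φ(i)`,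
(N2) `β^abs_Ξ + β^abs_{Ξ^ι} < 1`, (N3) `β_Ψ(i) < 1`, (N4) `0 ≤ α̲_F(i)`: the simplified rewrite holds with the
β-table `nobleBetaOfInputsCorr d i` — the generated table with the `βΔ` slot carrying the constant
`β^{corr}_{ΔR,F}(i)` that the bookkeeping of App. D Steps 3–5 yields (`betaRfDeltaCorr`; programme divergence
note D65 in the module docstring).  ALL six constants `c_Φ, α_Φ, R_Φ, c_F, α_F, R_F` are constructed and
(D.2), (D.3), (D.4), (D.14), (D.32) are PROVED; no analytic hypothesis of App. D remains.
[cite: FitznerVanDerHofstad2016NoBLE, Prop. 4.5 (p. 1088); §4.1.3 (4.15)–(4.19) (p. 1083); App. D (D.1)–(D.32)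
(pp. 1110–1117); Lemma 2.12 (p. 1063)] -/
theorem nobleSimplifiedFormAt_of_assumptions₅ (hp0 : 0 < (p : ℝ)) (hWF : NobleInputsWF d i)
    (hE : PercolationNobleEquationAt d p) (h41 : NobleAssumption41At d p S) (h43 : NobleAssumption43At d p S i)
    (hTRS : IsTRS (fun x => ∑ ι, S.xiIotaAI ι (x + 𝐞 ι)))
    (hI : ∀ N ≤ 1, IsTRS (fun x => ∑ ι, S.psiAI N ι (x + 𝐞 ι)))
    (hPi : IsTRS (fun x => ∑ ι, ∑ κ, S.piA ι κ (x + 𝐞 ι + 𝐞 κ)))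
    (hN1 : 0 ≤ BetaMap.betaCPhiLow d i.mu i.xiAlphaOneMinusZeroAtZero i.xiIotaAlphaIAtEi)
    (hN2 : i.xiAbs + i.xiIotaAbs < 1) (hN3 : (BetaMap.nobleBetaOfInputs d i).βΨ < 1)
    (hN4 : 0 ≤ (BetaMap.nobleBetaOfInputs d i).αFlow) :
    NobleSimplifiedFormAt d p (BetaMap.nobleBetaOfInputsCorr d i) := by
  haveI : NeZero d := ⟨by omega⟩
  have hp1 : (p : ℝ) < 1 :=
    lt_of_lt_of_le (show (p : ℝ) < (criticalProbI d : ℝ) by exact_mod_cast hp) (criticalProbI d).2.2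
  have hμ0 : 0 < nobleMu d p := nobleMu_pos (by omega) hp0 hp1
  have h := nobleL1At_of_assumption43 hd hp hp0 h43
  -- Lemma 3.1 inputs (module 1)
  set η : Fin d × Bool := (⟨0, by omega⟩, true) with hη
  obtain ⟨hrow, hcol⟩ := noble_pi_rowcol hd hp h41 h43 η
  have hψ : ∀ ι, ∑' x, noblePsi d p ι x = ∑' x, noblePsi d p η x := fun ι => noble_tsum_psi_eq hd hp h41 h43 ι η
  have hξι : ∀ ι, ∑' x, nobleXiIota d p ι x = ∑' x, nobleXiIota d p η x :=
    fun ι => noble_tsum_xiIota_eq h41 h43 ι η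
  have hψB := noble_psi_lower hd hp hp0 h41 h43 η
  have hπB := noble_pi_upper hd hp hp0 h43 η
  have hψ1 : -1 < ∑' x, noblePsi d p η x := by linarith
  have hΞ : (∑' x, |nobleXi d p x|) ≤ i.xiAbs :=
    (alternating_of_NSumLE (fun N x => nobleXiN_nonneg p N x) h43.xiAbs).2.1
  have hsmall : (∑' x, |nobleXi d p x|) + i.xiIotaAbs < 1 := by linarith
  have hβμ : (p : ℝ) ≤ (BetaMap.nobleBetaOfInputsCorr d i).βμ * nobleMu d p := h43.mubOverMu
  -- App. D Steps 1–2 (modules 2, 3b)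
  have hΞs : ∀ x, Summable fun N => nobleXiN d p N x :=
    (l1_of_NSumLE (fun N x => nobleXiN_nonneg p N x) h43.xiAbs).1
  have hΞι : ∀ ι x, Summable fun N => nobleXiIotaN d p (𝐞 ι) N x := fun ι =>
    (l1_of_NSumLE (fun N x => nobleXiIotaN_nonneg p (𝐞 ι) N x) (h43.xiIotaAbs ι)).1
  have hrem : ∀ x, nobleRem (noblePhi d p) (noblePhiAlpha S 0) (2 * d * noblePhiAlpha S (𝐞 η)) x =
      noblePhiRem S x := nobleRem_noblePhi_eq h h41 hTRS hΞs hΞι η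
  obtain ⟨hcL, hcU⟩ := noble_cPhi_bounds hWF h43
  have hαΦ := noble_alphaPhi_bound hWF h41 h43 hTRS η
  have hRΦ : ∑' x, |nobleRem (noblePhi d p) (noblePhiAlpha S 0) (2 * d * noblePhiAlpha S (𝐞 η)) x| ≤
      (BetaMap.nobleBetaOfInputsCorr d i).βRΦ := by
    rw [tsum_congr fun x => congrArg abs (hrem x)]
    exact (noblePhiRem_l1 hd hp hp0 h43).2.trans (noblePhiRemBound_le hd hWF h43)
  have hαF : (BetaMap.nobleBetaOfInputsCorr d i).αFlow ≤ nobleAlphaF S := noble_alphaF_lower (by omega) hWF h43 hN4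
  -- App. D Steps 3–5 (modules 3a, 3b, 3c): the majorant of `(R_F)₋` and Lemma 2.12
  have hsc := nobleScalarFacts_of hd hp hp0 hWF h43
  have ht1 : nobleMajT d i < 1 := hWF.1.tmp2_lt_one
  obtain ⟨hm, hm0, hmw, hβ⟩ := nobleMaj_data hsc h43 ht1
  have hT : IsTRS (nobleFAlpha S) := isTRS_nobleFAlpha h41 hI hPi
  have hΔ : ∀ k ∈ cube d, -((BetaMap.nobleBetaOfInputsCorr d i).βΔ * (1 - Dhat d k)) ≤
      cosFT (nobleRem (nobleF d p) (nobleCF S) (nobleAlphaF S)) 0 -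
        cosFT (nobleRem (nobleF d p) (nobleCF S) (nobleAlphaF S)) k := fun k _ =>
    nobleFRem_lower_of_majorant h hm hm0 hmw (isTRS_nobleMaj h41 hI hPi)
      (neg_nobleMaj_le_nobleFRem hd hp hsc h43 h hT ht1) hβ k
  exact nobleSimplifiedFormAt_of_bounds h hE hμ0 hψ hrow hcol hξι hψ1 hsmall _ hβμ (hN1.trans hcL) hcU hαΦ hαF
    hπB hψB hRΦ hΔ

/-- **Percolation instance** (`S := percolationNobleSplit d p`): Assumption 4.1 and the three shifted-`α` TRS
statements are theorems, so only the NoBLE equation, Assumption 4.3 with constants `i` and the four decidable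
sign conditions remain as hypotheses — NO analytic hypothesis of App. D.
[cite: FitznerVanDerHofstad2016NoBLE, Prop. 4.5 (p. 1088), App. D (pp. 1110–1117); FitznerVanDerHofstad2017, §3.5] -/
theorem nobleSimplifiedFormAt_percolation₅ (hp0 : 0 < (p : ℝ)) (hWF : NobleInputsWF d i)
    (hE : PercolationNobleEquationAt d p) (h43 : NobleAssumption43At d p (percolationNobleSplit d p hd hp) i)
    (hN1 : 0 ≤ BetaMap.betaCPhiLow d i.mu i.xiAlphaOneMinusZeroAtZero i.xiIotaAlphaIAtEi)
    (hN2 : i.xiAbs + i.xiIotaAbs < 1) (hN3 : (BetaMap.nobleBetaOfInputs d i).βΨ < 1)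
    (hN4 : 0 ≤ (BetaMap.nobleBetaOfInputs d i).αFlow) :
    NobleSimplifiedFormAt d p (BetaMap.nobleBetaOfInputsCorr d i) :=
  nobleSimplifiedFormAt_of_assumptions₅ hd hp hp0 hWF hE (nobleAssumption41At_percolation hd p hp) h43
    (percolationNobleSplit_xiIotaAI_shift_trs hd hp) (fun N _ => percolationNobleSplit_psiAI_shift_trs hd hp N)
    (percolationNobleSplit_piA_shift_trs hd hp) hN1 hN2 hN3 hN4

end Assembly5


end Literature.Probability.FitznerVanDerHofstad2017

end
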